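import Literature.Geometry.Lorentzian.KerrStarChartBounds
import Literature.Analysis.ODE.RecursiveSeries
import HarnessLib

/-!
# The horizon-regular solutions of the ingoing radial Klein–Gordon equation on Kerr:
# Frobenius series with parameters

Topic `Literature/Barriers/FinalStateConjecture` (namespace `Literature.Barriers.FinalStateConjecture`).
In the ingoing (Kerr-star / Kerr–Schild) chart the radial part `u = e^{−iωr} f` of a separated
Klein–Gordon mode `e^{−iωt}e^{imφ}S(θ)R(r)`, `R = e^{−i(ωt̄ − mφ̄)} f` (Shlapentokh-Rothman,
CMP 329 (2014), §2 (2.3)), solves the **ingoing radial equation**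
`Δ u'' + (Δ' + 2iam − 4iωMr) u' + (ω²(r² + 2Mr) − 2iωM − Λ − σ r²) u = 0`
(`Δ = r² − 2Mr + a² = (r − r₊)(r − r₋)`, `σ = μ²`; `ingoingRadial_of_radialODE` in
`KleinGordonSuperradiantInstabilityInputs.lean`). The horizon `r = r₊` is a regular singular
point with indicial exponents `0` and `−2ξ`, `ξ = i(am − 2Mr₊ω)/(r₊ − r₋)` (SR App. A, App. C
§C.1); smoothness of the mode across `𝓗⁺` is exactly the exponent-`0` (power series) behaviour
of `u`. This file constructs that solution for ALL sub-extremal `(M, a)`, `m ∈ ℤ`, and complex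
parameters `p = (ω, Λ, σ)` with `Im ω > −(r₊ − r₋)/(8Mr₊)` (which contains the closed upper
half-plane; the excluded values are where `d(k+1) + 2i(am − 2Mr₊ω)` may vanish), by the method
of undetermined coefficients in `x = r − r₊`:

`u = Σ cₖ xᵏ`, `c₀ = 1`,
`(k+1)(d(k+1) + 2iβ) c_{k+1} = −[(k² + k − 4iMωk + q₀) cₖ + q₁ c_{k−1} + q₂ c_{k−2}]`,

`d = r₊ − r₋`, `β = am − 2Mωr₊`, `q₂ = ω² − σ`, `q₁ = ω²(2r₊ + 2M) − 2σr₊`,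
`q₀ = ω²(r₊² + 2Mr₊) − 2iωM − Λ − σr₊²`. Everything is proved:

* `horCoeff M a m p k` — the coefficients, the recursion, smooth (indeed rational, pole-free)
  dependence on `p` on the half-space `Im ω > −d/(8Mr₊)`;
* the **contraction engine** (`Literature.Analysis.ODE.affineFix` on `ℕ →ᵇ ℂ`, as in
  `SpheroidalHarmonicSeries.lean`, but without polynomial weights): for parameters in the box
  `‖ω‖, ‖Λ‖, ‖σ‖ < R` the rescaled sequence `cₖ ρᵏ`, `ρ = ρ(M, a, m, R) > 0` explicit
  (`horRho`), is the fixed point of an operator of norm `≤ 1/2`, whence `‖cₖ‖ ≤ 2 ρ^{−k}` and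
  smoothness of `p ↦ (cₖ ρᵏ)ₖ ∈ ℕ →ᵇ ℂ` (`contDiffOn_horFix`);
* `horFun M a m p x = Σ cₖ xᵏ` on `‖x‖ < ρ/2`: convergence, `u(0) = 1`, the equation
  (`horFun_ode`), and **joint smoothness of `(x, p) ↦ u`** and of `∂ₓu` over `ℂ`
  (`contDiffOn_horFun`, `contDiffOn_horDer`).

Only SOME positive radius is produced (it shrinks with `R`); the continuation to `(r₊, ∞)` is
regular ODE theory and is done elsewhere. Not here: the second (singular) solution, the
`(r − r₊)^ξ` form in Boyer–Lindquist variables, reality statements.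

## References
* Y. Shlapentokh-Rothman, Comm. Math. Phys. 329 (2014) 859–891, §2 (2.3)–(2.4), App. A
  (Lemma A.1: regular singular points with parameters), App. C §C.1 (the horizon).
  Key `ShlapentokhRothman2014KleinGordon`.
* P. Hartman, *Ordinary Differential Equations*, SIAM Classics 38 (2002), Ch. IV §12 ((12.12)).
  Key `Hartman2002`.
-/

noncomputable section

open Set Filter Metric
open scoped Topology ContDiff

namespace Literature.Barriers.FinalStateConjecture

open Literature.Geometry.Lorentzian Literature.Analysis.ODE

/-! ### The constants of the recursion -/

section Constants

variable (M a : ℝ) (m : ℤ)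

/-- `d = r₊ − r₋` (positive for sub-extremal parameters). [folklore] -/
def horD : ℝ := Kerr.rPlus M a - Kerr.rMinus M a

/-- `β(ω) = am − 2Mωr₊`; `2iβ/d` is minus twice the horizon exponent `ξ` of SR §2 (2.4).
[cite: ShlapentokhRothman2014KleinGordon, §2 (2.4)] -/
def horBeta (w : ℂ) : ℂ := (a * m : ℝ) - 2 * M * w * Kerr.rPlus M a

/-- `q₂ = ω² − σ`. [folklore] -/
def horQ2 (p : ℂ × ℂ × ℂ) : ℂ := p.1 ^ 2 - p.2.2

/-- `q₁ = ω²(2r₊ + 2M) − 2σr₊`. [folklore] -/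
def horQ1 (p : ℂ × ℂ × ℂ) : ℂ :=
  p.1 ^ 2 * ((2 * Kerr.rPlus M a + 2 * M : ℝ) : ℂ) - 2 * p.2.2 * Kerr.rPlus M a

/-- `q₀ = ω²(r₊² + 2Mr₊) − 2iωM − Λ − σr₊²`. [folklore] -/
def horQ0 (p : ℂ × ℂ × ℂ) : ℂ :=
  p.1 ^ 2 * ((Kerr.rPlus M a ^ 2 + 2 * M * Kerr.rPlus M a : ℝ) : ℂ) - 2 * Complex.I * p.1 * M -
    p.2.1 - p.2.2 * ((Kerr.rPlus M a ^ 2 : ℝ) : ℂ)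

/-- The denominator `Dₖ(ω) = k (d k + 2iβ(ω))` of the recursion at output index `k`. [folklore] -/
def horDen (p : ℂ × ℂ × ℂ) (k : ℕ) : ℂ :=
  (k : ℂ) * ((horD M a : ℂ) * k + 2 * Complex.I * horBeta M a m p.1)

/-- The numerator multiplier `k² + k − 4iMωk + q₀` of `cₖ`. [folklore] -/
def horNum (p : ℂ × ℂ × ℂ) (k : ℕ) : ℂ :=
  (k : ℂ) ^ 2 + k - 4 * Complex.I * M * p.1 * k + horQ0 M a p

/-- The admissible half-space of frequencies `Im ω > −d/(8Mr₊)` (all denominators of the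
recursion are non-zero there). [folklore] -/
def horGood : Set (ℂ × ℂ × ℂ) := {p | -(horD M a / (8 * M * Kerr.rPlus M a)) < p.1.im}

end Constants

section ConstantsAPI

variable {M a : ℝ}

/-- `d > 0` for sub-extremal parameters. [folklore] -/
theorem horD_pos (h : Kerr.IsSubextremal M a) : 0 < horD M a := sub_pos.2 h.rMinus_lt_rPlus

/-- `r₊ > 0` for sub-extremal parameters. [folklore] -/
theorem rPlus_pos_of_isSubextremal (h : Kerr.IsSubextremal M a) : 0 < Kerr.rPlus M a :=
  h.rMinus_nonneg.trans_lt h.rMinus_lt_rPlus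

/-- The real part of `2iβ(ω)` is `4Mr₊ Im ω`. [folklore] -/
theorem re_two_I_horBeta (M a : ℝ) (m : ℤ) (w : ℂ) :
    (2 * Complex.I * horBeta M a m w).re = 4 * M * Kerr.rPlus M a * w.im := by
  simp [horBeta, Complex.mul_re, Complex.mul_im]
  ring

/-- On the good half-space, `re (d k + 2iβ) ≥ d k − d/2 ≥ d k / 2` for `k ≥ 1`; in particular
`‖d k + 2iβ‖ ≥ d k / 2`. [folklore] -/
theorem norm_horD_mul_add_ge (h : Kerr.IsSubextremal M a) (m : ℤ) {p : ℂ × ℂ × ℂ}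
    (hp : p ∈ horGood M a) {k : ℕ} (hk : 1 ≤ k) :
    horD M a * k / 2 ≤ ‖(horD M a : ℂ) * k + 2 * Complex.I * horBeta M a m p.1‖ := by
  have hd := horD_pos h
  have hM := h.pos
  have hr := rPlus_pos_of_isSubextremal h
  have hk1 : (1 : ℝ) ≤ k := by exact_mod_cast hk
  refine le_trans ?_ (Complex.re_le_norm _)
  rw [Complex.add_re, re_two_I_horBeta]
  have h1 : ((horD M a : ℂ) * k).re = horD M a * k := by simp
  rw [h1]
  have hp' : -(horD M a / (8 * M * Kerr.rPlus M a)) < p.1.im := hp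
  have h2 : -(horD M a / 2) ≤ 4 * M * Kerr.rPlus M a * p.1.im := by
    have hpos : 0 < 8 * M * Kerr.rPlus M a := by positivity
    have h3 : -(horD M a / (8 * M * Kerr.rPlus M a)) * (8 * M * Kerr.rPlus M a) <
        p.1.im * (8 * M * Kerr.rPlus M a) := mul_lt_mul_of_pos_right hp' hpos
    have h4 : -(horD M a / (8 * M * Kerr.rPlus M a)) * (8 * M * Kerr.rPlus M a) = -horD M a := by
      field_simp
    rw [h4] at h3
    linarith
  nlinarith

/-- On the good half-space the denominators `Dₖ`, `k ≥ 1`, do not vanish. [folklore] -/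
theorem horDen_ne_zero (h : Kerr.IsSubextremal M a) (m : ℤ) {p : ℂ × ℂ × ℂ} (hp : p ∈ horGood M a)
    {k : ℕ} (hk : 1 ≤ k) : horDen M a m p k ≠ 0 := by
  have hd := horD_pos h
  have hk1 : (1 : ℝ) ≤ k := by exact_mod_cast hk
  have h1 := norm_horD_mul_add_ge h m hp hk
  have hne : (horD M a : ℂ) * k + 2 * Complex.I * horBeta M a m p.1 ≠ 0 := by
    intro h0
    rw [h0, norm_zero] at h1
    nlinarith
  have hk0 : (k : ℂ) ≠ 0 := by exact_mod_cast (show k ≠ 0 by omega)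
  exact mul_ne_zero hk0 hne

/-- The good half-space is open. [folklore] -/
theorem isOpen_horGood (M a : ℝ) : IsOpen (horGood M a) :=
  isOpen_lt continuous_const (Complex.continuous_im.comp continuous_fst)

/-- The closed upper half-plane lies in the good half-space (sub-extremal parameters).
[folklore] -/
theorem mem_horGood_of_im_nonneg (h : Kerr.IsSubextremal M a) {p : ℂ × ℂ × ℂ} (hp : 0 ≤ p.1.im) :
    p ∈ horGood M a := by
  have : 0 < horD M a / (8 * M * Kerr.rPlus M a) :=
    div_pos (horD_pos h) (by have := h.pos; have := rPlus_pos_of_isSubextremal h; positivity)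
  show -(horD M a / (8 * M * Kerr.rPlus M a)) < p.1.im
  linarith

end ConstantsAPI

/-! ### The Frobenius coefficients -/

section Coeff

variable (M a : ℝ) (m : ℤ)

/-- Three consecutive coefficients `(cₖ, cₖ₊₁, cₖ₊₂)` of the horizon-regular solution
(`c₀ = 1`, `D₁ c₁ = −q₀`, `D₂ c₂ = −(N₁ c₁ + q₁)`,
`D_{k+3} c_{k+3} = −(N_{k+2} c_{k+2} + q₁ c_{k+1} + q₂ cₖ)`). SR App. A (Lemma A.1) for the radial
equation at `r₊` (App. C §C.1). [cite: ShlapentokhRothman2014KleinGordon, App. A Lemma A.1] -/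
def horTriple (p : ℂ × ℂ × ℂ) : ℕ → ℂ × ℂ × ℂ
  | 0 =>
    (1, -horQ0 M a p / horDen M a m p 1,
      -(horNum M a p 1 * (-horQ0 M a p / horDen M a m p 1) + horQ1 M a p) / horDen M a m p 2)
  | k + 1 =>
    ((horTriple p k).2.1, (horTriple p k).2.2,
      -(horNum M a p (k + 2) * (horTriple p k).2.2 + horQ1 M a p * (horTriple p k).2.1 +
          horQ2 p * (horTriple p k).1) / horDen M a m p (k + 3))

/-- **The Frobenius coefficients `cₖ(p)`** of the horizon-regular solution `Σ cₖ (r − r₊)ᵏ` of the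
ingoing radial equation. [cite: ShlapentokhRothman2014KleinGordon, App. A Lemma A.1] -/
def horCoeff (p : ℂ × ℂ × ℂ) (k : ℕ) : ℂ := (horTriple M a m p k).1

/-- `c₀ = 1`. [folklore] -/
@[simp] theorem horCoeff_zero (p : ℂ × ℂ × ℂ) : horCoeff M a m p 0 = 1 := rfl

/-- `c₁ = −q₀/D₁`. [folklore] -/
theorem horCoeff_one (p : ℂ × ℂ × ℂ) : horCoeff M a m p 1 = -horQ0 M a p / horDen M a m p 1 := rfl

/-- `c₂ = −(N₁ c₁ + q₁)/D₂`. [folklore] -/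
theorem horCoeff_two (p : ℂ × ℂ × ℂ) :
    horCoeff M a m p 2 = -(horNum M a p 1 * horCoeff M a m p 1 + horQ1 M a p) / horDen M a m p 2 := rfl

/-- The recursion `c_{k+3} = −(N_{k+2} c_{k+2} + q₁ c_{k+1} + q₂ cₖ)/D_{k+3}`. [folklore] -/
theorem horCoeff_add_three (p : ℂ × ℂ × ℂ) (k : ℕ) :
    horCoeff M a m p (k + 3) =
      -(horNum M a p (k + 2) * horCoeff M a m p (k + 2) + horQ1 M a p * horCoeff M a m p (k + 1) +
          horQ2 p * horCoeff M a m p k) / horDen M a m p (k + 3) := rfl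

variable {M a m}

/-- The recursion in multiplied-out form at `k = 0`: `D₁ c₁ = −q₀ c₀` (on the good half-space).
[folklore] -/
theorem horCoeff_rec_zero (h : Kerr.IsSubextremal M a) {p : ℂ × ℂ × ℂ} (hp : p ∈ horGood M a) :
    horDen M a m p 1 * horCoeff M a m p 1 = -(horNum M a p 0 * horCoeff M a m p 0) := by
  rw [horCoeff_one, horCoeff_zero, mul_div_cancel₀ _ (horDen_ne_zero h m hp le_rfl)]
  simp [horNum]

/-- The recursion at `k = 1`: `D₂ c₂ = −(N₁ c₁ + q₁ c₀)`. [folklore] -/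
theorem horCoeff_rec_one (h : Kerr.IsSubextremal M a) {p : ℂ × ℂ × ℂ} (hp : p ∈ horGood M a) :
    horDen M a m p 2 * horCoeff M a m p 2 =
      -(horNum M a p 1 * horCoeff M a m p 1 + horQ1 M a p * horCoeff M a m p 0) := by
  rw [horCoeff_two, horCoeff_zero, mul_div_cancel₀ _ (horDen_ne_zero h m hp (by norm_num)), mul_one]

/-- The recursion at `k + 2`: `D_{k+3} c_{k+3} = −(N_{k+2} c_{k+2} + q₁ c_{k+1} + q₂ cₖ)`.
[folklore] -/
theorem horCoeff_rec_add_two (h : Kerr.IsSubextremal M a) {p : ℂ × ℂ × ℂ} (hp : p ∈ horGood M a)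
    (k : ℕ) :
    horDen M a m p (k + 3) * horCoeff M a m p (k + 3) =
      -(horNum M a p (k + 2) * horCoeff M a m p (k + 2) + horQ1 M a p * horCoeff M a m p (k + 1) +
          horQ2 p * horCoeff M a m p k) := by
  rw [horCoeff_add_three, mul_div_cancel₀ _ (horDen_ne_zero h m hp (by omega))]

/-! ### Smoothness of the coefficients in the parameters -/

/-- The elementary constants are smooth (polynomial) in `p`. [folklore] -/
theorem contDiff_horQ0 (M a : ℝ) {n : WithTop ℕ∞} : ContDiff ℂ n (horQ0 M a) := by
  unfold horQ0; fun_prop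

/-- See `contDiff_horQ0`. [folklore] -/
theorem contDiff_horQ1 (M a : ℝ) {n : WithTop ℕ∞} : ContDiff ℂ n (horQ1 M a) := by
  unfold horQ1; fun_prop

/-- See `contDiff_horQ0`. [folklore] -/
theorem contDiff_horQ2 {n : WithTop ℕ∞} : ContDiff ℂ n horQ2 := by
  unfold horQ2; fun_prop

/-- See `contDiff_horQ0`. [folklore] -/
theorem contDiff_horBeta (M a : ℝ) (m : ℤ) {n : WithTop ℕ∞} :
    ContDiff ℂ n (fun p : ℂ × ℂ × ℂ ↦ horBeta M a m p.1) := by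
  unfold horBeta; fun_prop

/-- See `contDiff_horQ0`. [folklore] -/
theorem contDiff_horDen (M a : ℝ) (m : ℤ) (k : ℕ) {n : WithTop ℕ∞} :
    ContDiff ℂ n (fun p : ℂ × ℂ × ℂ ↦ horDen M a m p k) := by
  unfold horDen horBeta; fun_prop

/-- See `contDiff_horQ0`. [folklore] -/
theorem contDiff_horNum (M a : ℝ) (k : ℕ) {n : WithTop ℕ∞} :
    ContDiff ℂ n (fun p : ℂ × ℂ × ℂ ↦ horNum M a p k) := by
  unfold horNum horQ0; fun_prop

/-- **The coefficient triples depend smoothly on `p`** on the good half-space (rational functions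
whose denominators do not vanish there). [folklore] -/
theorem contDiffOn_horTriple (h : Kerr.IsSubextremal M a) (m : ℤ) (k : ℕ) {n : WithTop ℕ∞} :
    ContDiffOn ℂ n (fun p : ℂ × ℂ × ℂ ↦ horTriple M a m p k) (horGood M a) := by
  induction k with
  | zero =>
    simp only [horTriple]
    have h1 : ∀ p ∈ horGood M a, horDen M a m p 1 ≠ 0 := fun p hp ↦ horDen_ne_zero h m hp le_rfl
    have h2 : ∀ p ∈ horGood M a, horDen M a m p 2 ≠ 0 := fun p hp ↦ horDen_ne_zero h m hp (by norm_num)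
    refine contDiffOn_const.prodMk (ContDiffOn.prodMk ?_ ?_)
    · exact ((contDiff_horQ0 M a).neg.contDiffOn).div (contDiff_horDen M a m 1).contDiffOn h1
    · refine (ContDiffOn.neg ?_).div (contDiff_horDen M a m 2).contDiffOn h2
      exact ((contDiff_horNum M a 1).contDiffOn.mul
        (((contDiff_horQ0 M a).neg.contDiffOn).div (contDiff_horDen M a m 1).contDiffOn h1)).add
        (contDiff_horQ1 M a).contDiffOn
  | succ k ih =>
    simp only [horTriple]
    have h3 : ∀ p ∈ horGood M a, horDen M a m p (k + 3) ≠ 0 := fun p hp ↦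
      horDen_ne_zero h m hp (by omega)
    have i1 : ContDiffOn ℂ n (fun p : ℂ × ℂ × ℂ ↦ (horTriple M a m p k).1) (horGood M a) :=
      contDiff_fst.comp_contDiffOn ih
    have i2 : ContDiffOn ℂ n (fun p : ℂ × ℂ × ℂ ↦ (horTriple M a m p k).2.1) (horGood M a) :=
      contDiff_fst.comp_contDiffOn (contDiff_snd.comp_contDiffOn ih)
    have i3 : ContDiffOn ℂ n (fun p : ℂ × ℂ × ℂ ↦ (horTriple M a m p k).2.2) (horGood M a) :=
      contDiff_snd.comp_contDiffOn (contDiff_snd.comp_contDiffOn ih)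
    refine i2.prodMk (i3.prodMk ((ContDiffOn.neg ?_).div (contDiff_horDen M a m (k + 3)).contDiffOn h3))
    exact (((contDiff_horNum M a (k + 2)).contDiffOn.mul i3).add
      ((contDiff_horQ1 M a).contDiffOn.mul i2)).add (contDiff_horQ2.contDiffOn.mul i1)

/-- `p ↦ cₖ(p)` is smooth on the good half-space. [folklore] -/
theorem contDiffOn_horCoeff (h : Kerr.IsSubextremal M a) (m : ℤ) (k : ℕ) {n : WithTop ℕ∞} :
    ContDiffOn ℂ n (fun p : ℂ × ℂ × ℂ ↦ horCoeff M a m p k) (horGood M a) :=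
  contDiff_fst.comp_contDiffOn (contDiffOn_horTriple h m k)

end Coeff

/-! ### The contraction engine on `ℕ →ᵇ ℂ` -/

section Engine

open CSeq

/-- The bounded sequence `(1/k)ₖ` (`0` at `k = 0`, Lean's `0⁻¹ = 0`). [folklore] -/
def invIdx : CSeq := CSeq.mk (fun k ↦ ((k : ℂ))⁻¹) 1 fun k ↦ by
  rcases Nat.eq_zero_or_pos k with hk | hk
  · simp [hk]
  · rw [norm_inv, Complex.norm_natCast]
    exact inv_le_one_of_one_le₀ (by exact_mod_cast hk)

/-- Coordinates of `invIdx`. [folklore] -/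
@[simp] theorem invIdx_apply (k : ℕ) : invIdx k = ((k : ℂ))⁻¹ := rfl

/-- The affine pencil `1 + c · (1/k)ₖ` in the Banach algebra `ℕ →ᵇ ℂ`. [folklore] -/
def horUnitElem (c : ℂ) : CSeq := 1 + c • invIdx

/-- Coordinates: `(1 + c (1/k))ₖ = 1 + c/k`. [folklore] -/
theorem horUnitElem_apply (c : ℂ) (k : ℕ) : horUnitElem c k = 1 + c * ((k : ℂ))⁻¹ := by
  simp [horUnitElem]

/-- `c ↦ 1 + c · invIdx` is smooth (affine). [folklore] -/
theorem contDiff_horUnitElem {n : WithTop ℕ∞} : ContDiff ℂ n horUnitElem := by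
  unfold horUnitElem; fun_prop

/-- Lower bound for the entries: `‖1 + c/k‖ ≥ 1/2` when `re c > −1/2`. [folklore] -/
theorem half_le_norm_horUnitElem_apply {c : ℂ} (hc : -(1 / 2 : ℝ) < c.re) (k : ℕ) :
    (1 / 2 : ℝ) ≤ ‖1 + c * ((k : ℂ))⁻¹‖ := by
  rcases Nat.eq_zero_or_pos k with hk | hk
  · simp [hk]; norm_num
  · refine le_trans ?_ (Complex.re_le_norm _)
    have hk1 : (1 : ℝ) ≤ k := by exact_mod_cast hk
    have hkinv : ((k : ℂ))⁻¹ = (((k : ℝ)⁻¹ : ℝ) : ℂ) := by simp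
    rw [hkinv, Complex.add_re, Complex.one_re, Complex.mul_re, Complex.ofReal_re, Complex.ofReal_im,
      mul_zero, sub_zero]
    have h0 : 0 < (k : ℝ)⁻¹ := by positivity
    have h1 : (k : ℝ)⁻¹ ≤ 1 := inv_le_one_of_one_le₀ hk1
    rcases le_or_gt 0 c.re with hcr | hcr
    · nlinarith
    · nlinarith

/-- The explicit inverse `((1 + c/k)⁻¹)ₖ`, of norm `≤ 2` for `re c > −1/2`. [folklore] -/
def horUnitInv (c : ℂ) (hc : -(1 / 2 : ℝ) < c.re) : CSeq :=
  CSeq.mk (fun k ↦ (1 + c * ((k : ℂ))⁻¹)⁻¹) 2 fun k ↦ by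
    rw [norm_inv]
    have h := half_le_norm_horUnitElem_apply hc k
    calc ‖1 + c * ((k : ℂ))⁻¹‖⁻¹ ≤ (1 / 2 : ℝ)⁻¹ := inv_anti₀ (by norm_num) h
      _ = 2 := by norm_num

/-- Coordinates of the inverse. [folklore] -/
@[simp] theorem horUnitInv_apply {c : ℂ} (hc : -(1 / 2 : ℝ) < c.re) (k : ℕ) :
    horUnitInv c hc k = (1 + c * ((k : ℂ))⁻¹)⁻¹ := rfl

/-- `‖horUnitInv c‖ ≤ 2`. [folklore] -/
theorem norm_horUnitInv_le {c : ℂ} (hc : -(1 / 2 : ℝ) < c.re) : ‖horUnitInv c hc‖ ≤ 2 :=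
  CSeq.norm_mk_le zero_le_two _

/-- The pencil element is a unit with the explicit inverse (`re c > −1/2`). [folklore] -/
def horUnit {c : ℂ} (hc : -(1 / 2 : ℝ) < c.re) : CSeqˣ where
  val := horUnitElem c
  inv := horUnitInv c hc
  val_inv := by
    ext k
    have hne : (1 + c * ((k : ℂ))⁻¹) ≠ 0 := fun h0 ↦ by
      have h := half_le_norm_horUnitElem_apply hc k
      rw [h0, norm_zero] at h
      norm_num at h
    change horUnitElem c k * horUnitInv c hc k = 1
    rw [horUnitElem_apply, horUnitInv_apply, mul_inv_cancel₀ hne]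
  inv_val := by
    ext k
    have hne : (1 + c * ((k : ℂ))⁻¹) ≠ 0 := fun h0 ↦ by
      have h := half_le_norm_horUnitElem_apply hc k
      rw [h0, norm_zero] at h
      norm_num at h
    change horUnitInv c hc k * horUnitElem c k = 1
    rw [horUnitElem_apply, horUnitInv_apply, inv_mul_cancel₀ hne]

/-- `Ring.inverse (1 + c · invIdx) = horUnitInv c` for `re c > −1/2`. [folklore] -/
theorem ringInverse_horUnitElem {c : ℂ} (hc : -(1 / 2 : ℝ) < c.re) :
    Ring.inverse (horUnitElem c) = horUnitInv c hc := by
  rw [show horUnitElem c = ((horUnit hc : CSeqˣ) : CSeq) from rfl, Ring.inverse_unit]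
  rfl

variable (M a : ℝ) (m : ℤ)

/-- The pencil parameter `c(p) = 2iβ(ω)/d` of the horizon recursion (`re c = 4Mr₊ Im ω / d`).
[folklore] -/
def horC (p : ℂ × ℂ × ℂ) : ℂ := 2 * Complex.I * horBeta M a m p.1 / (horD M a : ℂ)

/-- **The resolvent factor** `J(p) = ((1 + c(p)/k)⁻¹)ₖ = Ring.inverse (1 + c(p) · invIdx)`, so that
`1/Dₖ = Jₖ /(d k²)`. [folklore] -/
def horJ (p : ℂ × ℂ × ℂ) : CSeq := Ring.inverse (horUnitElem (horC M a m p))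

variable {M a m}

/-- On the good half-space, `re c(p) > −1/2`. [folklore] -/
theorem re_horC_gt (h : Kerr.IsSubextremal M a) {p : ℂ × ℂ × ℂ} (hp : p ∈ horGood M a) :
    -(1 / 2 : ℝ) < (horC M a m p).re := by
  have hd := horD_pos h
  have hM := h.pos
  have hr := rPlus_pos_of_isSubextremal h
  have hre : (horC M a m p).re = 4 * M * Kerr.rPlus M a * p.1.im / horD M a := by
    rw [horC, show (2 * Complex.I * horBeta M a m p.1 / (horD M a : ℂ)) =
      (2 * Complex.I * horBeta M a m p.1) * (((horD M a)⁻¹ : ℝ) : ℂ) by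
        rw [Complex.ofReal_inv]; ring, Complex.re_mul_ofReal, re_two_I_horBeta]
    ring
  rw [hre]
  have hp' : -(horD M a / (8 * M * Kerr.rPlus M a)) < p.1.im := hp
  rw [lt_div_iff₀ hd]
  have hpos : 0 < 8 * M * Kerr.rPlus M a := by positivity
  have h3 : -(horD M a / (8 * M * Kerr.rPlus M a)) * (8 * M * Kerr.rPlus M a) <
      p.1.im * (8 * M * Kerr.rPlus M a) := mul_lt_mul_of_pos_right hp' hpos
  have h4 : -(horD M a / (8 * M * Kerr.rPlus M a)) * (8 * M * Kerr.rPlus M a) = -horD M a := by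
    field_simp
  rw [h4] at h3
  linarith

/-- On the good half-space `J(p)` is the explicit inverse. [folklore] -/
theorem horJ_eq (h : Kerr.IsSubextremal M a) {p : ℂ × ℂ × ℂ} (hp : p ∈ horGood M a) :
    horJ M a m p = horUnitInv (horC M a m p) (re_horC_gt h hp) :=
  ringInverse_horUnitElem _

/-- Coordinates of `J(p)`: `Jₖ = (1 + c/k)⁻¹`. [folklore] -/
theorem horJ_apply (h : Kerr.IsSubextremal M a) {p : ℂ × ℂ × ℂ} (hp : p ∈ horGood M a) (k : ℕ) :
    horJ M a m p k = (1 + horC M a m p * ((k : ℂ))⁻¹)⁻¹ := by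
  rw [horJ_eq h hp, horUnitInv_apply]

/-- `‖J(p)‖ ≤ 2` on the good half-space. [folklore] -/
theorem norm_horJ_le (h : Kerr.IsSubextremal M a) {p : ℂ × ℂ × ℂ} (hp : p ∈ horGood M a) :
    ‖horJ M a m p‖ ≤ 2 := by
  rw [horJ_eq h hp]; exact norm_horUnitInv_le _

/-- `Dₖ = d k² (1 + c/k)`, i.e. `Jₖ = d k² / Dₖ`, for `k ≥ 1` on the good half-space. [folklore] -/
theorem horDen_eq (h : Kerr.IsSubextremal M a) (p : ℂ × ℂ × ℂ) {k : ℕ} (hk : 1 ≤ k) :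
    horDen M a m p k = (horD M a : ℂ) * (k : ℂ) ^ 2 * (1 + horC M a m p * ((k : ℂ))⁻¹) := by
  have hk0 : (k : ℂ) ≠ 0 := by exact_mod_cast (show k ≠ 0 by omega)
  have hd0 : (horD M a : ℂ) ≠ 0 := by exact_mod_cast (horD_pos h).ne'
  unfold horDen horC
  field_simp

/-- `p ↦ J(p)` is smooth on the good half-space (inversion is smooth at units). [folklore] -/
theorem contDiffOn_horJ (h : Kerr.IsSubextremal M a) (m : ℤ) {n : WithTop ℕ∞} :
    ContDiffOn ℂ n (horJ M a m) (horGood M a) := by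
  intro p hp
  have hc : ContDiff ℂ n (horC M a m) := by unfold horC horBeta; fun_prop
  have hinv : ContDiffAt ℂ n (Ring.inverse : CSeq → CSeq) (horUnitElem (horC M a m p)) := by
    have hh := contDiffAt_ringInverse ℂ (n := n) (horUnit (re_horC_gt (m := m) h hp))
    exact hh
  exact (hinv.comp p ((contDiff_horUnitElem.comp hc).contDiffAt)).contDiffWithinAt

/-! #### The fixed symbol sequences -/

/-- `Aₖ = −(ρ/d)(k−1)/k` (the `k²+k` part of the one-step multiplier; `0` at `k = 0`). [folklore] -/
def horSeqA (d ρ : ℝ) : ℕ → ℝ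
  | 0 => 0
  | k + 1 => -(ρ / d) * k / (k + 1)

/-- `Bₖ = 4Mρ(k−1)/(d k²)` (multiplies `iω`; `0` at `k = 0`). [folklore] -/
def horSeqB (M d ρ : ℝ) : ℕ → ℝ
  | 0 => 0
  | k + 1 => 4 * M * ρ * k / (d * (k + 1) ^ 2)

/-- `Cₖ = −ρ/(d k²)` (multiplies `q₀`; `0` at `k = 0`). [folklore] -/
def horSeqC (d ρ : ℝ) : ℕ → ℝ
  | 0 => 0
  | k + 1 => -ρ / (d * (k + 1) ^ 2)

/-- `Eₖ⁽¹⁾ = −ρ²/(d k²)` for `k ≥ 2` (multiplies `q₁`). [folklore] -/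
def horSeqE1 (d ρ : ℝ) : ℕ → ℝ
  | 0 => 0
  | 1 => 0
  | k + 2 => -ρ ^ 2 / (d * (k + 2) ^ 2)

/-- `Eₖ⁽²⁾ = −ρ³/(d k²)` for `k ≥ 3` (multiplies `q₂`). [folklore] -/
def horSeqE2 (d ρ : ℝ) : ℕ → ℝ
  | 0 => 0
  | 1 => 0
  | 2 => 0
  | k + 3 => -ρ ^ 3 / (d * (k + 3) ^ 2)

/-- `k/(k+1)² ≤ 1/4`-type bound: `4k ≤ (k+1)²`. [folklore] -/
theorem four_mul_le_succ_sq (k : ℕ) : 4 * (k : ℝ) ≤ ((k : ℝ) + 1) ^ 2 := by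
  nlinarith [sq_nonneg ((k : ℝ) - 1)]

/-- `|Aₖ| ≤ |ρ|/|d|`. [folklore] -/
theorem abs_horSeqA_le (d ρ : ℝ) (k : ℕ) : |horSeqA d ρ k| ≤ |ρ| / |d| := by
  cases k with
  | zero => simp [horSeqA]; positivity
  | succ k =>
    simp only [horSeqA]
    have hk : (0 : ℝ) ≤ k := k.cast_nonneg
    rw [show -(ρ / d) * k / (k + 1) = -(ρ / d * (k / (k + 1))) by ring, abs_neg, abs_mul, abs_div,
      abs_of_nonneg (show (0 : ℝ) ≤ k / (k + 1) by positivity)]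
    have : (k : ℝ) / (k + 1) ≤ 1 := (div_le_one (by positivity)).2 (by linarith)
    calc |ρ| / |d| * (k / (k + 1)) ≤ |ρ| / |d| * 1 := by gcongr
      _ = |ρ| / |d| := mul_one _

/-- `|Bₖ| ≤ |M||ρ|/|d|` (from `4k ≤ (k+1)²`). [folklore] -/
theorem abs_horSeqB_le (M d ρ : ℝ) (k : ℕ) : |horSeqB M d ρ k| ≤ |M| * |ρ| / |d| := by
  cases k with
  | zero => simp [horSeqB]; positivity
  | succ k =>
    simp only [horSeqB]
    have hk : (0 : ℝ) ≤ k := k.cast_nonneg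
    have hsq : (0 : ℝ) < ((k : ℝ) + 1) ^ 2 := by positivity
    rw [show 4 * M * ρ * k / (d * ((k : ℝ) + 1) ^ 2) = (M * ρ / d) * (4 * k / ((k : ℝ) + 1) ^ 2) by
      field_simp, abs_mul, abs_div, abs_mul,
      abs_of_nonneg (show (0 : ℝ) ≤ 4 * k / ((k : ℝ) + 1) ^ 2 by positivity)]
    have : 4 * (k : ℝ) / ((k : ℝ) + 1) ^ 2 ≤ 1 := (div_le_one hsq).2 (four_mul_le_succ_sq k)
    calc |M| * |ρ| / |d| * (4 * k / ((k : ℝ) + 1) ^ 2) ≤ |M| * |ρ| / |d| * 1 := by gcongr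
      _ = |M| * |ρ| / |d| := mul_one _

/-- `|Cₖ| ≤ |ρ|/|d|`. [folklore] -/
theorem abs_horSeqC_le (d ρ : ℝ) (k : ℕ) : |horSeqC d ρ k| ≤ |ρ| / |d| := by
  cases k with
  | zero => simp [horSeqC]; positivity
  | succ k =>
    simp only [horSeqC]
    have hsq : (1 : ℝ) ≤ ((k : ℝ) + 1) ^ 2 := by nlinarith [k.cast_nonneg (α := ℝ)]
    rw [show -ρ / (d * ((k : ℝ) + 1) ^ 2) = -(ρ / d * (1 / ((k : ℝ) + 1) ^ 2)) by field_simp,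
      abs_neg, abs_mul, abs_div, abs_of_nonneg (show (0 : ℝ) ≤ 1 / ((k : ℝ) + 1) ^ 2 by positivity)]
    have : 1 / ((k : ℝ) + 1) ^ 2 ≤ 1 := (div_le_one (by positivity)).2 hsq
    calc |ρ| / |d| * (1 / ((k : ℝ) + 1) ^ 2) ≤ |ρ| / |d| * 1 := by gcongr
      _ = |ρ| / |d| := mul_one _

/-- `|Eₖ⁽¹⁾| ≤ ρ²/(4|d|)`. [folklore] -/
theorem abs_horSeqE1_le (d ρ : ℝ) (k : ℕ) : |horSeqE1 d ρ k| ≤ ρ ^ 2 / (4 * |d|) := by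
  match k with
  | 0 => simp [horSeqE1]; positivity
  | 1 => simp [horSeqE1]; positivity
  | k + 2 =>
    simp only [horSeqE1]
    have hsq : (4 : ℝ) ≤ ((k : ℝ) + 2) ^ 2 := by nlinarith [k.cast_nonneg (α := ℝ)]
    rw [show -ρ ^ 2 / (d * ((k : ℝ) + 2) ^ 2) = -(ρ ^ 2 / d * (1 / ((k : ℝ) + 2) ^ 2)) by field_simp,
      abs_neg, abs_mul, abs_div, abs_of_nonneg (sq_nonneg ρ),
      abs_of_nonneg (show (0 : ℝ) ≤ 1 / ((k : ℝ) + 2) ^ 2 by positivity)]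
    have : 1 / ((k : ℝ) + 2) ^ 2 ≤ 1 / 4 := by
      rw [div_le_div_iff₀ (by positivity) (by norm_num)]; linarith
    calc ρ ^ 2 / |d| * (1 / ((k : ℝ) + 2) ^ 2) ≤ ρ ^ 2 / |d| * (1 / 4) := by gcongr
      _ = ρ ^ 2 / (4 * |d|) := by ring

/-- `|Eₖ⁽²⁾| ≤ |ρ|³/(9|d|)`. [folklore] -/
theorem abs_horSeqE2_le (d ρ : ℝ) (k : ℕ) : |horSeqE2 d ρ k| ≤ |ρ| ^ 3 / (9 * |d|) := by
  match k with
  | 0 => simp [horSeqE2]; positivity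
  | 1 => simp [horSeqE2]; positivity
  | 2 => simp [horSeqE2]; positivity
  | k + 3 =>
    simp only [horSeqE2]
    have hsq : (9 : ℝ) ≤ ((k : ℝ) + 3) ^ 2 := by nlinarith [k.cast_nonneg (α := ℝ)]
    rw [show -ρ ^ 3 / (d * ((k : ℝ) + 3) ^ 2) = -(ρ ^ 3 / d * (1 / ((k : ℝ) + 3) ^ 2)) by field_simp,
      abs_neg, abs_mul, abs_div, abs_pow,
      abs_of_nonneg (show (0 : ℝ) ≤ 1 / ((k : ℝ) + 3) ^ 2 by positivity)]
    have : 1 / ((k : ℝ) + 3) ^ 2 ≤ 1 / 9 := by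
      rw [div_le_div_iff₀ (by positivity) (by norm_num)]; linarith
    calc |ρ| ^ 3 / |d| * (1 / ((k : ℝ) + 3) ^ 2) ≤ |ρ| ^ 3 / |d| * (1 / 9) := by gcongr
      _ = |ρ| ^ 3 / (9 * |d|) := by ring

/-- The fixed symbol sequences as elements of `ℕ →ᵇ ℂ`. [folklore] -/
def csHorA (d ρ : ℝ) : CSeq := CSeq.mk (fun k ↦ (horSeqA d ρ k : ℂ)) (|ρ| / |d|) fun k ↦ by
  rw [Complex.norm_real, Real.norm_eq_abs]; exact abs_horSeqA_le d ρ k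

/-- See `csHorA`. [folklore] -/
def csHorB (M d ρ : ℝ) : CSeq := CSeq.mk (fun k ↦ (horSeqB M d ρ k : ℂ)) (|M| * |ρ| / |d|) fun k ↦ by
  rw [Complex.norm_real, Real.norm_eq_abs]; exact abs_horSeqB_le M d ρ k

/-- See `csHorA`. [folklore] -/
def csHorC (d ρ : ℝ) : CSeq := CSeq.mk (fun k ↦ (horSeqC d ρ k : ℂ)) (|ρ| / |d|) fun k ↦ by
  rw [Complex.norm_real, Real.norm_eq_abs]; exact abs_horSeqC_le d ρ k

/-- See `csHorA`. [folklore] -/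
def csHorE1 (d ρ : ℝ) : CSeq := CSeq.mk (fun k ↦ (horSeqE1 d ρ k : ℂ)) (ρ ^ 2 / (4 * |d|)) fun k ↦ by
  rw [Complex.norm_real, Real.norm_eq_abs]; exact abs_horSeqE1_le d ρ k

/-- See `csHorA`. [folklore] -/
def csHorE2 (d ρ : ℝ) : CSeq := CSeq.mk (fun k ↦ (horSeqE2 d ρ k : ℂ)) (|ρ| ^ 3 / (9 * |d|)) fun k ↦ by
  rw [Complex.norm_real, Real.norm_eq_abs]; exact abs_horSeqE2_le d ρ k

/-- `‖csHorA d ρ‖ ≤ |ρ|/|d|`. [folklore] -/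
theorem norm_csHorA_le (d ρ : ℝ) : ‖csHorA d ρ‖ ≤ |ρ| / |d| := CSeq.norm_mk_le (by positivity) _

/-- `‖csHorB M d ρ‖ ≤ |M||ρ|/|d|`. [folklore] -/
theorem norm_csHorB_le (M d ρ : ℝ) : ‖csHorB M d ρ‖ ≤ |M| * |ρ| / |d| := CSeq.norm_mk_le (by positivity) _

/-- `‖csHorC d ρ‖ ≤ |ρ|/|d|`. [folklore] -/
theorem norm_csHorC_le (d ρ : ℝ) : ‖csHorC d ρ‖ ≤ |ρ| / |d| := CSeq.norm_mk_le (by positivity) _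

/-- `‖csHorE1 d ρ‖ ≤ ρ²/(4|d|)`. [folklore] -/
theorem norm_csHorE1_le (d ρ : ℝ) : ‖csHorE1 d ρ‖ ≤ ρ ^ 2 / (4 * |d|) := CSeq.norm_mk_le (by positivity) _

/-- `‖csHorE2 d ρ‖ ≤ |ρ|³/(9|d|)`. [folklore] -/
theorem norm_csHorE2_le (d ρ : ℝ) : ‖csHorE2 d ρ‖ ≤ |ρ| ^ 3 / (9 * |d|) := CSeq.norm_mk_le (by positivity) _

/-! #### The recursion operator -/

variable (M a m)

/-- The three multiplier symbols of the rescaled recursion `bₖ = cₖ ρᵏ`: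
`d₀(p) = J(p) · (A + iω B + q₀ C)`, `d₁(p) = J(p) · q₁ E⁽¹⁾`, `d₂(p) = J(p) · q₂ E⁽²⁾`.
[folklore] -/
def horSym (ρ : ℝ) (p : ℂ × ℂ × ℂ) : Fin 3 → CSeq :=
  ![horJ M a m p * (csHorA (horD M a) ρ + (Complex.I * p.1) • csHorB M (horD M a) ρ +
      horQ0 M a p • csHorC (horD M a) ρ),
    horJ M a m p * (horQ1 M a p • csHorE1 (horD M a) ρ),
    horJ M a m p * (horQ2 p • csHorE2 (horD M a) ρ)]

/-- **The recursion operator** of the rescaled horizon recursion.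
[cite: Hartman2002, Ch. IV §12 (12.12)] -/
def horOp (ρ : ℝ) (p : ℂ × ℂ × ℂ) : CSeq →L[ℂ] CSeq := CSeq.recOp 3 (horSym M a m ρ p)

/-- **The rescaled Frobenius sequence** `bₖ = cₖ ρᵏ` as the fixed point of the recursion operator
(meaningful where `‖horOp‖ < 1`). [cite: Hartman2002, Ch. IV §12 (12.12)] -/
def horFix (ρ : ℝ) (p : ℂ × ℂ × ℂ) : CSeq := affineFix (horOp M a m ρ p) CSeq.unit

/-- The target of the identification: `bₖ = cₖ ρᵏ`. [folklore] -/
def horResc (ρ : ℝ) (p : ℂ × ℂ × ℂ) (k : ℕ) : ℂ := horCoeff M a m p k * (ρ : ℂ) ^ k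

variable {M a m}

/-- `p ↦ horOp ρ p` is smooth on the good half-space. [folklore] -/
theorem contDiffOn_horOp (h : Kerr.IsSubextremal M a) (m : ℤ) (ρ : ℝ) {n : WithTop ℕ∞} :
    ContDiffOn ℂ n (fun p : ℂ × ℂ × ℂ ↦ horOp M a m ρ p) (horGood M a) := by
  unfold horOp
  refine (CSeq.contDiff_recOp 3).comp_contDiffOn ?_
  refine contDiffOn_pi.2 fun j ↦ ?_
  have hJ := contDiffOn_horJ (n := n) h m
  have hQ0 := (contDiff_horQ0 (n := n) M a).contDiffOn (s := horGood M a)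
  have hQ1 := (contDiff_horQ1 (n := n) M a).contDiffOn (s := horGood M a)
  have hQ2 := (contDiff_horQ2 (n := n)).contDiffOn (s := horGood M a)
  have hw : ContDiffOn ℂ n (fun p : ℂ × ℂ × ℂ ↦ Complex.I * p.1) (horGood M a) := by fun_prop
  fin_cases j
  · simp only [horSym, Fin.zero_eta, Matrix.cons_val_zero]
    exact hJ.mul ((contDiffOn_const.add (hw.smul contDiffOn_const)).add (hQ0.smul contDiffOn_const))
  · simp only [horSym, Fin.mk_one, Matrix.cons_val_one, Matrix.cons_val_zero]
    exact hJ.mul (hQ1.smul contDiffOn_const)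
  · simp only [horSym, Fin.reduceFinMk, Matrix.cons_val]
    exact hJ.mul (hQ2.smul contDiffOn_const)

/-- Coordinates of the one-step symbol. [folklore] -/
theorem horSym_zero_apply (ρ : ℝ) (p : ℂ × ℂ × ℂ) (k : ℕ) :
    horSym M a m ρ p 0 k = horJ M a m p k *
      ((horSeqA (horD M a) ρ k : ℂ) + Complex.I * p.1 * (horSeqB M (horD M a) ρ k : ℂ) +
        horQ0 M a p * (horSeqC (horD M a) ρ k : ℂ)) := by
  simp only [horSym, Fin.isValue, Matrix.cons_val_zero, BoundedContinuousFunction.coe_mul,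
    BoundedContinuousFunction.coe_add, BoundedContinuousFunction.coe_smul, Pi.mul_apply, Pi.add_apply,
    smul_eq_mul]
  simp [csHorA, csHorB, csHorC, mul_assoc]

/-- Coordinates of the two-step symbol. [folklore] -/
theorem horSym_one_apply (ρ : ℝ) (p : ℂ × ℂ × ℂ) (k : ℕ) :
    horSym M a m ρ p 1 k = horJ M a m p k * (horQ1 M a p * (horSeqE1 (horD M a) ρ k : ℂ)) := by
  simp only [horSym, Fin.isValue, Matrix.cons_val_one, Matrix.cons_val_zero,
    BoundedContinuousFunction.coe_mul, BoundedContinuousFunction.coe_smul, Pi.mul_apply,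
    smul_eq_mul]
  simp [csHorE1]

/-- Coordinates of the three-step symbol. [folklore] -/
theorem horSym_two_apply (ρ : ℝ) (p : ℂ × ℂ × ℂ) (k : ℕ) :
    horSym M a m ρ p 2 k = horJ M a m p k * (horQ2 p * (horSeqE2 (horD M a) ρ k : ℂ)) := by
  simp only [horSym, Fin.isValue, Matrix.cons_val, BoundedContinuousFunction.coe_mul,
    BoundedContinuousFunction.coe_smul, Pi.mul_apply, smul_eq_mul]
  simp [csHorE2]

/-! #### The rescaled recursion and the identification of the fixed point -/

/-- The pencil entries do not vanish on the good half-space. [folklore] -/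
theorem one_add_horC_mul_ne_zero (h : Kerr.IsSubextremal M a) {p : ℂ × ℂ × ℂ} (hp : p ∈ horGood M a)
    (k : ℕ) : (1 + horC M a m p * ((k : ℂ))⁻¹) ≠ 0 := fun h0 ↦ by
  have h1 := half_le_norm_horUnitElem_apply (re_horC_gt (m := m) h hp) k
  rw [h0, norm_zero] at h1
  norm_num at h1

/-- Factoring the resolvent entry out of the three-term combination. [folklore] -/
theorem horJ_factor (J X Y Z B₂ B₁ B₀ : ℂ) :
    J * X * B₂ + J * Y * B₁ + J * Z * B₀ = J * (X * B₂ + Y * B₁ + Z * B₀) := by ring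

/-- The rescaled sequence satisfies the rescaled recursion: step to index `1`. [folklore] -/
theorem horResc_step_zero (h : Kerr.IsSubextremal M a) {p : ℂ × ℂ × ℂ} (hp : p ∈ horGood M a) (ρ : ℝ) :
    horResc M a m ρ p 1 = horSym M a m ρ p 0 1 * horResc M a m ρ p 0 := by
  have hrec := horCoeff_rec_zero (m := m) h hp
  have hd0 : (horD M a : ℂ) ≠ 0 := by exact_mod_cast (horD_pos h).ne'
  rw [horDen_eq (m := m) h p le_rfl] at hrec
  rw [horSym_zero_apply, horJ_apply h hp, mul_assoc,
    eq_inv_mul_iff_mul_eq₀ (one_add_horC_mul_ne_zero (m := m) h hp 1)]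
  simp only [horResc, horSeqA, horSeqB, horSeqC, horCoeff_zero, horNum] at hrec ⊢
  push_cast at hrec ⊢
  field_simp
  field_simp at hrec
  linear_combination (ρ : ℂ) * hrec

/-- The rescaled recursion: step to index `2`. [folklore] -/
theorem horResc_step_one (h : Kerr.IsSubextremal M a) {p : ℂ × ℂ × ℂ} (hp : p ∈ horGood M a) (ρ : ℝ) :
    horResc M a m ρ p 2 =
      horSym M a m ρ p 0 2 * horResc M a m ρ p 1 + horSym M a m ρ p 1 2 * horResc M a m ρ p 0 := by
  have hrec := horCoeff_rec_one (m := m) h hp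
  have hd0 : (horD M a : ℂ) ≠ 0 := by exact_mod_cast (horD_pos h).ne'
  rw [horDen_eq (m := m) h p (by norm_num)] at hrec
  rw [horSym_zero_apply, horSym_one_apply, horJ_apply h hp,
    show ∀ (J X Y B₁ B₀ : ℂ), J * X * B₁ + J * Y * B₀ = J * (X * B₁ + Y * B₀) from fun _ _ _ _ _ ↦ by ring,
    eq_inv_mul_iff_mul_eq₀ (one_add_horC_mul_ne_zero (m := m) h hp 2)]
  simp only [horResc, horSeqA, horSeqB, horSeqC, horSeqE1, horCoeff_zero, horNum] at hrec ⊢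
  push_cast at hrec ⊢
  field_simp
  field_simp at hrec
  linear_combination 8 * (ρ : ℂ) ^ 2 * hrec

/-- The rescaled recursion: step to index `k + 3`. [folklore] -/
theorem horResc_step_add_two (h : Kerr.IsSubextremal M a) {p : ℂ × ℂ × ℂ} (hp : p ∈ horGood M a) (ρ : ℝ)
    (k : ℕ) :
    horResc M a m ρ p (k + 3) =
      horSym M a m ρ p 0 (k + 3) * horResc M a m ρ p (k + 2) + horSym M a m ρ p 1 (k + 3) * horResc M a m ρ p (k + 1) +
        horSym M a m ρ p 2 (k + 3) * horResc M a m ρ p k := by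
  have hrec := horCoeff_rec_add_two (m := m) h hp k
  have hd0 : (horD M a : ℂ) ≠ 0 := by exact_mod_cast (horD_pos h).ne'
  have hk3 : ((k : ℂ) + 3) ≠ 0 := by
    have : (0 : ℝ) < (k : ℝ) + 3 := by positivity
    exact_mod_cast this.ne'
  rw [horDen_eq (m := m) h p (by omega)] at hrec
  -- the recursion with the pencil entry multiplied out
  have hrec' : (horD M a : ℂ) * (((k : ℂ) + 3) ^ 2 + horC M a m p * ((k : ℂ) + 3)) *
      horCoeff M a m p (k + 3) =
      -((((k : ℂ) + 2) ^ 2 + ((k : ℂ) + 2) - 4 * Complex.I * M * p.1 * ((k : ℂ) + 2) + horQ0 M a p) *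
          horCoeff M a m p (k + 2) + horQ1 M a p * horCoeff M a m p (k + 1) + horQ2 p * horCoeff M a m p k) := by
    have hR : -((((k : ℂ) + 2) ^ 2 + ((k : ℂ) + 2) - 4 * Complex.I * M * p.1 * ((k : ℂ) + 2) + horQ0 M a p) *
          horCoeff M a m p (k + 2) + horQ1 M a p * horCoeff M a m p (k + 1) + horQ2 p * horCoeff M a m p k) =
        -(horNum M a p (k + 2) * horCoeff M a m p (k + 2) + horQ1 M a p * horCoeff M a m p (k + 1) +
          horQ2 p * horCoeff M a m p k) := by
      simp only [horNum]; push_cast; ring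
    rw [hR, ← hrec]
    push_cast
    field_simp
  rw [horSym_zero_apply, horSym_one_apply, horSym_two_apply, horJ_apply h hp, horJ_factor,
    eq_inv_mul_iff_mul_eq₀ (one_add_horC_mul_ne_zero (m := m) h hp (k + 3))]
  simp only [horResc, horSeqA, horSeqB, horSeqC, horSeqE1, horSeqE2]
  push_cast
  have h21 : (k : ℂ) + 2 + 1 = (k : ℂ) + 3 := by ring
  have h12 : (k : ℂ) + 1 + 2 = (k : ℂ) + 3 := by ring
  simp only [h21, h12]
  field_simp
  linear_combination (ρ : ℂ) ^ (k + 3) * hrec'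

/-- **Identification of the fixed point**: where the recursion operator is a contraction, its fixed
point is the rescaled Frobenius sequence `bₖ = cₖ ρᵏ`. [cite: Hartman2002, Ch. IV §12 (12.12)] -/
theorem horFix_apply (h : Kerr.IsSubextremal M a) {p : ℂ × ℂ × ℂ} (hp : p ∈ horGood M a) {ρ : ℝ}
    (hT : ‖horOp M a m ρ p‖ < 1) (k : ℕ) : horFix M a m ρ p k = horResc M a m ρ p k := by
  induction k using Nat.strong_induction_on with
  | _ k ih =>
    match k with
    | 0 =>
      rw [horFix, horOp, affineFix_recOp_apply_zero hT]
      simp [horResc]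
    | 1 =>
      have e0 : affineFix (CSeq.recOp 3 (horSym M a m ρ p)) CSeq.unit 0 = horResc M a m ρ p 0 := ih 0 (by omega)
      rw [horFix, horOp, affineFix_recOp_apply_succ hT, Fin.sum_univ_three]
      simp only [Fin.val_zero, Fin.val_one, Fin.val_two, CSeq.unit_apply_succ, zero_add]
      rw [if_pos le_rfl, if_neg (by omega), if_neg (by omega), add_zero, add_zero, Nat.sub_zero, e0,
        horResc_step_zero h hp]
    | 2 =>
      have e0 : affineFix (CSeq.recOp 3 (horSym M a m ρ p)) CSeq.unit 0 = horResc M a m ρ p 0 := ih 0 (by omega)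
      have e1 : affineFix (CSeq.recOp 3 (horSym M a m ρ p)) CSeq.unit 1 = horResc M a m ρ p 1 := ih 1 (by omega)
      rw [horFix, horOp, affineFix_recOp_apply_succ hT, Fin.sum_univ_three]
      simp only [Fin.val_zero, Fin.val_one, Fin.val_two, CSeq.unit_apply_succ, zero_add]
      rw [if_pos (by omega), if_pos le_rfl, if_neg (by omega), add_zero, Nat.sub_zero, Nat.sub_self, e0, e1,
        horResc_step_one h hp]
    | k + 3 =>
      have e0 : affineFix (CSeq.recOp 3 (horSym M a m ρ p)) CSeq.unit k = horResc M a m ρ p k := ih k (by omega)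
      have e1 : affineFix (CSeq.recOp 3 (horSym M a m ρ p)) CSeq.unit (k + 1) = horResc M a m ρ p (k + 1) :=
        ih (k + 1) (by omega)
      have e2 : affineFix (CSeq.recOp 3 (horSym M a m ρ p)) CSeq.unit (k + 2) = horResc M a m ρ p (k + 2) :=
        ih (k + 2) (by omega)
      rw [horFix, horOp, affineFix_recOp_apply_succ hT, Fin.sum_univ_three]
      simp only [Fin.val_zero, Fin.val_one, Fin.val_two, CSeq.unit_apply_succ, zero_add]
      rw [if_pos (by omega), if_pos (by omega), if_pos (by omega), Nat.sub_zero,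
        show k + 2 - 1 = k + 1 from rfl, show k + 2 - 2 = k from rfl, e0, e1, e2, horResc_step_add_two h hp]

/-! #### The contraction estimate on a parameter box -/

variable (M a)

/-- A bound for `‖q₀‖` on the box `‖ω‖, ‖Λ‖, ‖σ‖ ≤ R`. [folklore] -/
def horQ0Bound (R : ℝ) : ℝ :=
  R ^ 2 * (Kerr.rPlus M a ^ 2 + 2 * M * Kerr.rPlus M a) + 2 * R * M + R + R * Kerr.rPlus M a ^ 2

/-- A bound for `‖q₁‖` on the box. [folklore] -/
def horQ1Bound (R : ℝ) : ℝ := R ^ 2 * (2 * Kerr.rPlus M a + 2 * M) + 2 * R * Kerr.rPlus M a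

/-- A bound for `‖q₂‖` on the box. [folklore] -/
def horQ2Bound (R : ℝ) : ℝ := R ^ 2 + R

/-- The constant `L(R)` with `‖horOp ρ p‖ ≤ ρ L(R)` for `ρ ≤ 1` on the box. [folklore] -/
def horL (R : ℝ) : ℝ :=
  (2 + 2 * R * M + 2 * horQ0Bound M a R + horQ1Bound M a R + horQ2Bound R) / horD M a

/-- **The radius** `ρ(R) = min 1 (1/(2 L(R)))`: with this rescaling the recursion operator is a
`1/2`-contraction on the box, so the Frobenius series converges for `|r − r₊| < ρ(R)`. [folklore] -/
def horRho (R : ℝ) : ℝ := min 1 (1 / (2 * horL M a R))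

/-- The closed parameter box `‖ω‖, ‖Λ‖, ‖σ‖ ≤ R`. [folklore] -/
def horBoxClosed (R : ℝ) : Set (ℂ × ℂ × ℂ) := {p | ‖p.1‖ ≤ R ∧ ‖p.2.1‖ ≤ R ∧ ‖p.2.2‖ ≤ R}

/-- The open parameter box `‖ω‖, ‖Λ‖, ‖σ‖ < R`. [folklore] -/
def horBox (R : ℝ) : Set (ℂ × ℂ × ℂ) := {p | ‖p.1‖ < R ∧ ‖p.2.1‖ < R ∧ ‖p.2.2‖ < R}

variable {M a}

/-- The open box is open. [folklore] -/
theorem isOpen_horBox (R : ℝ) : IsOpen (horBox R) :=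
  (isOpen_lt continuous_fst.norm continuous_const).inter
    ((isOpen_lt (continuous_fst.comp continuous_snd).norm continuous_const).inter
      (isOpen_lt (continuous_snd.comp continuous_snd).norm continuous_const))

/-- The open box lies in the closed box. [folklore] -/
theorem horBox_subset_horBoxClosed (R : ℝ) : horBox R ⊆ horBoxClosed R := fun _ hp ↦
  ⟨hp.1.le, hp.2.1.le, hp.2.2.le⟩

/-- `‖q₀(p)‖ ≤ Q₀(R)` on the closed box (`M ≥ 0`). [folklore] -/
theorem norm_horQ0_le (hM : 0 ≤ M) {R : ℝ} {p : ℂ × ℂ × ℂ} (hp : p ∈ horBoxClosed R) :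
    ‖horQ0 M a p‖ ≤ horQ0Bound M a R := by
  obtain ⟨h1, h2, h3⟩ := hp
  have hr : 0 ≤ Kerr.rPlus M a ^ 2 + 2 * M * Kerr.rPlus M a := by
    have := Kerr.rMinus_le_rPlus M a
    unfold Kerr.rPlus at this ⊢
    nlinarith [Real.sqrt_nonneg (M ^ 2 - a ^ 2), sq_nonneg (M + Real.sqrt (M ^ 2 - a ^ 2))]
  unfold horQ0 horQ0Bound
  have e1 : ‖p.1 ^ 2 * ((Kerr.rPlus M a ^ 2 + 2 * M * Kerr.rPlus M a : ℝ) : ℂ)‖ ≤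
      R ^ 2 * (Kerr.rPlus M a ^ 2 + 2 * M * Kerr.rPlus M a) := by
    rw [norm_mul, norm_pow, Complex.norm_real, Real.norm_eq_abs, abs_of_nonneg hr]
    gcongr
  have e2 : ‖2 * Complex.I * p.1 * M‖ ≤ 2 * R * M := by
    rw [norm_mul, norm_mul, norm_mul, Complex.norm_I, Complex.norm_real, Real.norm_eq_abs, abs_of_nonneg hM]
    norm_num
    gcongr
  have e4 : ‖p.2.2 * ((Kerr.rPlus M a ^ 2 : ℝ) : ℂ)‖ ≤ R * Kerr.rPlus M a ^ 2 := by
    rw [norm_mul, Complex.norm_real, Real.norm_eq_abs, abs_of_nonneg (sq_nonneg _)]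
    gcongr
  calc _ ≤ ‖p.1 ^ 2 * ((Kerr.rPlus M a ^ 2 + 2 * M * Kerr.rPlus M a : ℝ) : ℂ)‖ + ‖2 * Complex.I * p.1 * M‖ +
        ‖p.2.1‖ + ‖p.2.2 * ((Kerr.rPlus M a ^ 2 : ℝ) : ℂ)‖ := by
          refine (norm_sub_le _ _).trans (add_le_add ((norm_sub_le _ _).trans (add_le_add
            (norm_sub_le _ _) le_rfl)) le_rfl)
    _ ≤ _ := by linarith

/-- `‖q₁(p)‖ ≤ Q₁(R)` on the closed box (`M ≥ 0`, `r₊ ≥ 0`). [folklore] -/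
theorem norm_horQ1_le (hM : 0 ≤ M) (hr : 0 ≤ Kerr.rPlus M a) {R : ℝ} {p : ℂ × ℂ × ℂ}
    (hp : p ∈ horBoxClosed R) : ‖horQ1 M a p‖ ≤ horQ1Bound M a R := by
  obtain ⟨h1, h2, h3⟩ := hp
  unfold horQ1 horQ1Bound
  have e1 : ‖p.1 ^ 2 * ((2 * Kerr.rPlus M a + 2 * M : ℝ) : ℂ)‖ ≤ R ^ 2 * (2 * Kerr.rPlus M a + 2 * M) := by
    rw [norm_mul, norm_pow, Complex.norm_real, Real.norm_eq_abs, abs_of_nonneg (by positivity)]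
    gcongr
  have e2 : ‖2 * p.2.2 * (Kerr.rPlus M a : ℂ)‖ ≤ 2 * R * Kerr.rPlus M a := by
    rw [norm_mul, norm_mul, Complex.norm_real, Real.norm_eq_abs, abs_of_nonneg hr]
    norm_num
    gcongr
  calc _ ≤ ‖p.1 ^ 2 * ((2 * Kerr.rPlus M a + 2 * M : ℝ) : ℂ)‖ + ‖2 * p.2.2 * (Kerr.rPlus M a : ℂ)‖ :=
        norm_sub_le _ _
    _ ≤ _ := by linarith

/-- `‖q₂(p)‖ ≤ Q₂(R)` on the closed box. [folklore] -/
theorem norm_horQ2_le {R : ℝ} {p : ℂ × ℂ × ℂ} (hp : p ∈ horBoxClosed R) :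
    ‖horQ2 p‖ ≤ horQ2Bound R := by
  obtain ⟨h1, h2, h3⟩ := hp
  unfold horQ2 horQ2Bound
  calc _ ≤ ‖p.1 ^ 2‖ + ‖p.2.2‖ := norm_sub_le _ _
    _ ≤ R ^ 2 + R := by rw [norm_pow]; gcongr

/-- `L(R) > 0` and `ρ(R) > 0` (sub-extremal parameters, `R ≥ 0`). [folklore] -/
theorem horL_pos (h : Kerr.IsSubextremal M a) {R : ℝ} (hR : 0 ≤ R) : 0 < horL M a R := by
  have hd := horD_pos h
  have hM := h.pos
  have hr := rPlus_pos_of_isSubextremal h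
  unfold horL horQ0Bound horQ1Bound horQ2Bound
  positivity

/-- `ρ(R) > 0`. [folklore] -/
theorem horRho_pos (h : Kerr.IsSubextremal M a) {R : ℝ} (hR : 0 ≤ R) : 0 < horRho M a R :=
  lt_min zero_lt_one (by have := horL_pos h hR; positivity)

/-- `ρ(R) ≤ 1`. [folklore] -/
theorem horRho_le_one (M a : ℝ) (R : ℝ) : horRho M a R ≤ 1 := min_le_left _ _

/-- `ρ(R) L(R) ≤ 1/2`. [folklore] -/
theorem horRho_mul_horL_le (h : Kerr.IsSubextremal M a) {R : ℝ} (hR : 0 ≤ R) :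
    horRho M a R * horL M a R ≤ 1 / 2 := by
  have hL := horL_pos h hR
  calc horRho M a R * horL M a R ≤ 1 / (2 * horL M a R) * horL M a R := by
        gcongr; exact min_le_right _ _
    _ = 1 / 2 := by field_simp

/-- **The contraction estimate**: on the box `‖ω‖, ‖Λ‖, ‖σ‖ ≤ R` (inside the good half-space) the
rescaled recursion operator with `ρ = ρ(R)` has norm `≤ 1/2`. [folklore] -/
theorem norm_horOp_le (h : Kerr.IsSubextremal M a) (m : ℤ) {R : ℝ} (hR : 0 ≤ R) {p : ℂ × ℂ × ℂ}
    (hp : p ∈ horGood M a) (hpR : p ∈ horBoxClosed R) : ‖horOp M a m (horRho M a R) p‖ ≤ 1 / 2 := by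
  have hd := horD_pos h
  have hM := h.pos
  have hr := rPlus_pos_of_isSubextremal h
  set ρ := horRho M a R with hρ_def
  have hρ0 : 0 < ρ := horRho_pos h hR
  have hρ1 : ρ ≤ 1 := horRho_le_one M a R
  have hρabs : |ρ| = ρ := abs_of_pos hρ0
  have hdabs : |horD M a| = horD M a := abs_of_pos hd
  have hJ := norm_horJ_le (m := m) h hp
  have hQ0 := norm_horQ0_le (a := a) hM.le hpR
  have hQ1 := norm_horQ1_le hM.le hr.le hpR
  have hQ2 := norm_horQ2_le hpR
  have hQ0nn : 0 ≤ horQ0Bound M a R := (norm_nonneg _).trans hQ0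
  have hQ1nn : 0 ≤ horQ1Bound M a R := (norm_nonneg _).trans hQ1
  have hQ2nn : 0 ≤ horQ2Bound R := (norm_nonneg _).trans hQ2
  -- norms of the fixed sequences
  have hA : ‖csHorA (horD M a) ρ‖ ≤ ρ / horD M a := by
    have := norm_csHorA_le (horD M a) ρ; rwa [hρabs, hdabs] at this
  have hB : ‖csHorB M (horD M a) ρ‖ ≤ M * ρ / horD M a := by
    have := norm_csHorB_le M (horD M a) ρ; rwa [hρabs, hdabs, abs_of_pos hM] at this
  have hC : ‖csHorC (horD M a) ρ‖ ≤ ρ / horD M a := by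
    have := norm_csHorC_le (horD M a) ρ; rwa [hρabs, hdabs] at this
  have hE1 : ‖csHorE1 (horD M a) ρ‖ ≤ ρ ^ 2 / (4 * horD M a) := by
    have := norm_csHorE1_le (horD M a) ρ; rwa [hdabs] at this
  have hE2 : ‖csHorE2 (horD M a) ρ‖ ≤ ρ ^ 3 / (9 * horD M a) := by
    have := norm_csHorE2_le (horD M a) ρ; rwa [hρabs, hdabs] at this
  -- the three symbols
  have h0 : ‖horSym M a m ρ p 0‖ ≤ 2 * (ρ / horD M a * (1 + R * M + horQ0Bound M a R)) := by
    have hω : ‖Complex.I * p.1‖ ≤ R := by rw [norm_mul, Complex.norm_I, one_mul]; exact hpR.1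
    calc ‖horSym M a m ρ p 0‖ ≤ ‖horJ M a m p‖ * ‖csHorA (horD M a) ρ + (Complex.I * p.1) • csHorB M (horD M a) ρ +
          horQ0 M a p • csHorC (horD M a) ρ‖ := norm_mul_le _ _
      _ ≤ 2 * (ρ / horD M a + R * (M * ρ / horD M a) + horQ0Bound M a R * (ρ / horD M a)) := by
          refine mul_le_mul hJ ?_ (norm_nonneg _) zero_le_two
          refine (norm_add_le _ _).trans (add_le_add ((norm_add_le _ _).trans (add_le_add hA ?_)) ?_)
          · rw [norm_smul]; exact mul_le_mul hω hB (norm_nonneg _) hR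
          · rw [norm_smul]; exact mul_le_mul hQ0 hC (norm_nonneg _) hQ0nn
      _ = 2 * (ρ / horD M a * (1 + R * M + horQ0Bound M a R)) := by ring
  have h1 : ‖horSym M a m ρ p 1‖ ≤ 2 * (horQ1Bound M a R * (ρ ^ 2 / (4 * horD M a))) := by
    calc ‖horSym M a m ρ p 1‖ ≤ ‖horJ M a m p‖ * ‖horQ1 M a p • csHorE1 (horD M a) ρ‖ := norm_mul_le _ _
      _ ≤ 2 * (horQ1Bound M a R * (ρ ^ 2 / (4 * horD M a))) := by
          refine mul_le_mul hJ ?_ (norm_nonneg _) zero_le_two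
          rw [norm_smul]; exact mul_le_mul hQ1 hE1 (norm_nonneg _) hQ1nn
  have h2 : ‖horSym M a m ρ p 2‖ ≤ 2 * (horQ2Bound R * (ρ ^ 3 / (9 * horD M a))) := by
    calc ‖horSym M a m ρ p 2‖ ≤ ‖horJ M a m p‖ * ‖horQ2 p • csHorE2 (horD M a) ρ‖ := norm_mul_le _ _
      _ ≤ 2 * (horQ2Bound R * (ρ ^ 3 / (9 * horD M a))) := by
          refine mul_le_mul hJ ?_ (norm_nonneg _) zero_le_two
          rw [norm_smul]; exact mul_le_mul hQ2 hE2 (norm_nonneg _) hQ2nn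
  refine (CSeq.norm_recOp_le 3 _).trans ?_
  rw [Fin.sum_univ_three]
  have hρ2 : ρ ^ 2 ≤ ρ := by nlinarith
  have hρ3 : ρ ^ 3 ≤ ρ := by nlinarith
  have hsum : 2 * (ρ / horD M a * (1 + R * M + horQ0Bound M a R)) +
      2 * (horQ1Bound M a R * (ρ ^ 2 / (4 * horD M a))) + 2 * (horQ2Bound R * (ρ ^ 3 / (9 * horD M a))) ≤
      ρ * horL M a R := by
    have hL : ρ * horL M a R =
        ρ * (2 + 2 * R * M + 2 * horQ0Bound M a R + horQ1Bound M a R + horQ2Bound R) / horD M a := by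
      unfold horL; ring
    rw [hL, le_div_iff₀ hd]
    have e : (2 * (ρ / horD M a * (1 + R * M + horQ0Bound M a R)) +
        2 * (horQ1Bound M a R * (ρ ^ 2 / (4 * horD M a))) +
        2 * (horQ2Bound R * (ρ ^ 3 / (9 * horD M a)))) * horD M a =
        2 * ρ * (1 + R * M + horQ0Bound M a R) + horQ1Bound M a R * ρ ^ 2 / 2 +
          2 * horQ2Bound R * ρ ^ 3 / 9 := by
      field_simp
      ring
    rw [e]
    nlinarith [mul_nonneg hQ1nn (sub_nonneg.2 hρ2), mul_nonneg hQ2nn (sub_nonneg.2 hρ3), hρ0.le]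
  calc ‖horSym M a m ρ p 0‖ + ‖horSym M a m ρ p 1‖ + ‖horSym M a m ρ p 2‖
      ≤ 2 * (ρ / horD M a * (1 + R * M + horQ0Bound M a R)) +
        2 * (horQ1Bound M a R * (ρ ^ 2 / (4 * horD M a))) + 2 * (horQ2Bound R * (ρ ^ 3 / (9 * horD M a))) := by
          linarith
    _ ≤ ρ * horL M a R := hsum
    _ ≤ 1 / 2 := horRho_mul_horL_le h hR

/-! #### Consequences: smoothness of the fixed point, geometric coefficient bound -/

/-- **Smoothness of the rescaled Frobenius sequence in the parameters** on
`horGood ∩ horBox R`: `p ↦ horFix ρ(R) p ∈ ℕ →ᵇ ℂ` is `C^∞` over `ℂ`. [folklore] -/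
theorem contDiffOn_horFix (h : Kerr.IsSubextremal M a) (m : ℤ) {R : ℝ} (hR : 0 ≤ R) {n : WithTop ℕ∞} :
    ContDiffOn ℂ n (fun p : ℂ × ℂ × ℂ ↦ horFix M a m (horRho M a R) p) (horGood M a ∩ horBox R) :=
  contDiffOn_affineFix ((isOpen_horGood M a).inter (isOpen_horBox R))
    ((contDiffOn_horOp h m _).mono inter_subset_left) contDiffOn_const
    (fun p hp ↦ (norm_horOp_le h m hR hp.1 (horBox_subset_horBoxClosed R hp.2)).trans_lt (by norm_num))

/-- **Geometric bound on the Frobenius coefficients**: `‖cₖ(p)‖ ≤ 2 ρ(R)^{−k}` for `p` in the good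
half-space with `‖ω‖, ‖Λ‖, ‖σ‖ ≤ R`. [cite: Hartman2002, Ch. IV §12 (12.12)] -/
theorem norm_horCoeff_le (h : Kerr.IsSubextremal M a) (m : ℤ) {R : ℝ} (hR : 0 ≤ R) {p : ℂ × ℂ × ℂ}
    (hp : p ∈ horGood M a) (hpR : p ∈ horBoxClosed R) (k : ℕ) :
    ‖horCoeff M a m p k‖ ≤ 2 * ((horRho M a R)⁻¹) ^ k := by
  set ρ := horRho M a R with hρ_def
  have hρ0 : 0 < ρ := horRho_pos h hR
  have hT : ‖horOp M a m ρ p‖ ≤ 1 / 2 := norm_horOp_le h m hR hp hpR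
  have hT1 : ‖horOp M a m ρ p‖ < 1 := hT.trans_lt (by norm_num)
  have hfix : ‖horFix M a m ρ p‖ ≤ 2 := by
    refine (norm_affineFix_le hT1 CSeq.unit).trans ?_
    have hu : ‖CSeq.unit‖ ≤ 1 := CSeq.norm_mk_le zero_le_one _
    rw [div_le_iff₀ (by linarith)]
    linarith
  have hk := (CSeq.norm_apply_le (horFix M a m ρ p) k).trans hfix
  rw [horFix_apply h hp hT1 k, horResc, norm_mul, norm_pow, Complex.norm_real, Real.norm_eq_abs,
    abs_of_pos hρ0] at hk
  have hpow : (0 : ℝ) < ρ ^ k := by positivity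
  rw [inv_pow, ← div_eq_mul_inv, le_div_iff₀ hpow]
  exact hk

end Engine

/-! ### The solution `Σ cₖ xᵏ`: convergence, the differential equation -/

section Solution

variable (M a : ℝ) (m : ℤ)

/-- **The horizon-regular Frobenius solution** `u(x; p) = Σₖ cₖ(p) xᵏ` of the ingoing radial
equation (`x = r − r₊`, complex `x`; Mathlib's junk value `0` off the disc of convergence).
[cite: ShlapentokhRothman2014KleinGordon, App. C §C.1] -/
def horFun (p : ℂ × ℂ × ℂ) (x : ℂ) : ℂ := ∑' k, horCoeff M a m p k * x ^ k

/-- The evaluation radius `s₀ = ρ(R)/2` as a complex number. [folklore] -/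
def horS0 (R : ℝ) : ℂ := (horRho M a R : ℂ) / 2

/-- The coefficients rescaled to the evaluation radius: `aₖ = cₖ s₀ᵏ`. [folklore] -/
def horRescEval (R : ℝ) (p : ℂ × ℂ × ℂ) (k : ℕ) : ℂ := horCoeff M a m p k * horS0 M a R ^ k

/-- The unit-disc variable scale `1/s₀ = 2/ρ`. [folklore] -/
def horScale (R : ℝ) : ℂ := 2 / (horRho M a R : ℂ)

/-- The first `x`-derivative `u' = (1/s₀) Σ (D a)ₖ sᵏ`, `s = x/s₀`. [folklore] -/
def horDer (R : ℝ) (p : ℂ × ℂ × ℂ) (x : ℂ) : ℂ :=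
  horScale M a R * cseries (dSeq (horRescEval M a m R p)) (horScale M a R * x)

/-- The second `x`-derivative `u'' = (1/s₀)² Σ (D² a)ₖ sᵏ`. [folklore] -/
def horDer2 (R : ℝ) (p : ℂ × ℂ × ℂ) (x : ℂ) : ℂ :=
  horScale M a R ^ 2 * cseries (dSeq (dSeq (horRescEval M a m R p))) (horScale M a R * x)

/-- The coefficient combination produced by inserting the series into the ingoing equation,
multiplied by `s₀` (variable `s = x/s₀`):
`s₀ S²(D²a) + d S(D²a) + (2 − 4iMω) s₀ S(Da) + (d + 2iβ) Da + q₂ s₀³ S²a + q₁ s₀² S a + q₀ s₀ a`.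
[folklore] -/
def horODECoeff (R : ℝ) (p : ℂ × ℂ × ℂ) (k : ℕ) : ℂ :=
  horS0 M a R * shiftSeq (shiftSeq (dSeq (dSeq (horRescEval M a m R p)))) k +
    (horD M a : ℂ) * shiftSeq (dSeq (dSeq (horRescEval M a m R p))) k +
    (2 - 4 * Complex.I * M * p.1) * horS0 M a R * shiftSeq (dSeq (horRescEval M a m R p)) k +
    ((horD M a : ℂ) + 2 * Complex.I * horBeta M a m p.1) * dSeq (horRescEval M a m R p) k +
    horQ2 p * horS0 M a R ^ 3 * shiftSeq (shiftSeq (horRescEval M a m R p)) k +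
    horQ1 M a p * horS0 M a R ^ 2 * shiftSeq (horRescEval M a m R p) k +
    horQ0 M a p * horS0 M a R * horRescEval M a m R p k

variable {M a m}

/-- `s₀ · (1/s₀) = 1`. [folklore] -/
theorem horS0_mul_horScale (h : Kerr.IsSubextremal M a) {R : ℝ} (hR : 0 ≤ R) :
    horS0 M a R * horScale M a R = 1 := by
  have hρ0 : (horRho M a R : ℂ) ≠ 0 := by exact_mod_cast (horRho_pos h hR).ne'
  unfold horS0 horScale
  field_simp

/-- `s₀ ≠ 0`. [folklore] -/
theorem horS0_ne_zero (h : Kerr.IsSubextremal M a) {R : ℝ} (hR : 0 ≤ R) : horS0 M a R ≠ 0 := by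
  have hρ0 : (horRho M a R : ℂ) ≠ 0 := by exact_mod_cast (horRho_pos h hR).ne'
  unfold horS0
  exact div_ne_zero hρ0 two_ne_zero

/-- `‖s₀‖ = ρ/2`. [folklore] -/
theorem norm_horS0 (h : Kerr.IsSubextremal M a) {R : ℝ} (hR : 0 ≤ R) : ‖horS0 M a R‖ = horRho M a R / 2 := by
  have hρ0 := horRho_pos h hR
  rw [horS0, norm_div, Complex.norm_real, Real.norm_eq_abs, abs_of_pos hρ0]
  norm_num

section
variable (h : Kerr.IsSubextremal M a) (m : ℤ) {R : ℝ} (hR : 0 ≤ R) {p : ℂ × ℂ × ℂ} (hp : p ∈ horGood M a)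
  (hpR : p ∈ horBoxClosed R)
include h hR hp hpR

/-- `aₖ` is bounded (`‖aₖ‖ ≤ 2 (1/2)ᵏ ≤ 2`), in particular polynomially bounded. [folklore] -/
theorem polyBounded_horRescEval : PolyBounded (horRescEval M a m R p) := by
  refine PolyBounded.of_norm_le (C := 2) fun k ↦ ?_
  have hρ0 := horRho_pos h hR
  have hk := norm_horCoeff_le h m hR hp hpR k
  rw [horRescEval, norm_mul, norm_pow, norm_horS0 h hR]
  calc ‖horCoeff M a m p k‖ * (horRho M a R / 2) ^ k ≤ 2 * (horRho M a R)⁻¹ ^ k * (horRho M a R / 2) ^ k := by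
        gcongr
    _ = 2 * (1 / 2) ^ k := by
        rw [mul_assoc, ← mul_pow]; congr 2; field_simp
    _ ≤ 2 * 1 := by gcongr; exact pow_le_one₀ (by norm_num) (by norm_num)
    _ = 2 := mul_one _

end

/-- For `‖x‖ < ρ/2` the rescaled point lies in the unit disc. [folklore] -/
theorem norm_horScale_mul_lt (h : Kerr.IsSubextremal M a) {R : ℝ} (hR : 0 ≤ R) {x : ℂ}
    (hx : ‖x‖ < horRho M a R / 2) : ‖horScale M a R * x‖ < 1 := by
  have hρ0 := horRho_pos h hR
  rw [horScale, norm_mul, norm_div, Complex.norm_real, Real.norm_eq_abs, abs_of_pos hρ0]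
  norm_num
  rw [lt_div_iff₀ zero_lt_two] at hx
  calc 2 / horRho M a R * ‖x‖ = ‖x‖ * 2 / horRho M a R := by ring
    _ < 1 := by rw [div_lt_one hρ0]; exact hx

/-- The terms agree: `cₖ xᵏ = aₖ sᵏ` with `s = x/s₀`. [folklore] -/
theorem horCoeff_mul_pow_eq (h : Kerr.IsSubextremal M a) (m : ℤ) {R : ℝ} (hR : 0 ≤ R) (p : ℂ × ℂ × ℂ)
    (x : ℂ) (k : ℕ) :
    horCoeff M a m p k * x ^ k = horRescEval M a m R p k * (horScale M a R * x) ^ k := by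
  rw [horRescEval, mul_pow, mul_assoc, ← mul_assoc (_ ^ k), ← mul_pow, horS0_mul_horScale h hR, one_pow,
    one_mul]

/-- **The solution as a unit-disc series**: `u(x) = Σ aₖ sᵏ`. [folklore] -/
theorem horFun_eq_cseries (h : Kerr.IsSubextremal M a) (m : ℤ) {R : ℝ} (hR : 0 ≤ R) (p : ℂ × ℂ × ℂ) (x : ℂ) :
    horFun M a m p x = cseries (horRescEval M a m R p) (horScale M a R * x) := by
  rw [horFun, cseries]
  exact tsum_congr fun k ↦ horCoeff_mul_pow_eq h m hR p x k

/-- `u(0) = 1`. [folklore] -/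
theorem horFun_zero (h : Kerr.IsSubextremal M a) (m : ℤ) (p : ℂ × ℂ × ℂ) : horFun M a m p 0 = 1 := by
  rw [horFun_eq_cseries h m le_rfl (R := 0), mul_zero, cseries_zero_right, horRescEval, horCoeff_zero]
  simp

section
variable (h : Kerr.IsSubextremal M a) (m : ℤ) {R : ℝ} (hR : 0 ≤ R) {p : ℂ × ℂ × ℂ} (hp : p ∈ horGood M a)
  (hpR : p ∈ horBoxClosed R)
include h hR hp hpR

/-- **Convergence**: `HasSum (cₖ xᵏ) (u x)` for `‖x‖ < ρ(R)/2`. [folklore] -/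
theorem hasSum_horFun {x : ℂ} (hx : ‖x‖ < horRho M a R / 2) :
    HasSum (fun k ↦ horCoeff M a m p k * x ^ k) (horFun M a m p x) := by
  have hs := hasSum_cseries (polyBounded_horRescEval h m hR hp hpR) (norm_horScale_mul_lt h hR hx)
  rw [← horFun_eq_cseries h m hR] at hs
  exact hs.congr_fun fun k ↦ (horCoeff_mul_pow_eq h m hR p x k)

/-- **`u` is differentiable with `u' = horDer`** on `‖x‖ < ρ/2`. [folklore] -/
theorem hasDerivAt_horFun {x : ℂ} (hx : ‖x‖ < horRho M a R / 2) :
    HasDerivAt (horFun M a m p) (horDer M a m R p x) x := by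
  have hd := hasDerivAt_cseries (polyBounded_horRescEval h m hR hp hpR) (norm_horScale_mul_lt h hR hx)
  have hlin : HasDerivAt (fun x : ℂ ↦ horScale M a R * x) (horScale M a R) x := by
    simpa using (hasDerivAt_id x).const_mul (horScale M a R)
  have h2 := hd.comp x hlin
  have hfun : horFun M a m p = fun x ↦ cseries (horRescEval M a m R p) (horScale M a R * x) :=
    funext fun x ↦ horFun_eq_cseries h m hR p x
  rw [hfun, horDer, mul_comm]
  exact h2

/-- **`u'` is differentiable with derivative `horDer2`** on `‖x‖ < ρ/2`. [folklore] -/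
theorem hasDerivAt_horDer {x : ℂ} (hx : ‖x‖ < horRho M a R / 2) :
    HasDerivAt (horDer M a m R p) (horDer2 M a m R p x) x := by
  have hd := hasDerivAt_cseries (polyBounded_horRescEval h m hR hp hpR).dSeq (norm_horScale_mul_lt h hR hx)
  have hlin : HasDerivAt (fun x : ℂ ↦ horScale M a R * x) (horScale M a R) x := by
    simpa using (hasDerivAt_id x).const_mul (horScale M a R)
  have h2 := (hd.comp x hlin).const_mul (horScale M a R)
  have hfun : horDer M a m R p = fun x ↦ horScale M a R *
      cseries (dSeq (horRescEval M a m R p)) (horScale M a R * x) := rfl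
  rw [hfun]
  refine h2.congr_deriv ?_
  rw [horDer2]
  ring

end

/-- **The recursion kills every coefficient of the inserted series.** [cite: Hartman2002, Ch. IV §12 (12.12)] -/
theorem horODECoeff_eq_zero (h : Kerr.IsSubextremal M a) (m : ℤ) (R : ℝ) {p : ℂ × ℂ × ℂ} (hp : p ∈ horGood M a)
    (k : ℕ) : horODECoeff M a m R p k = 0 := by
  match k with
  | 0 =>
    have hrec := horCoeff_rec_zero (m := m) h hp
    simp only [horODECoeff, shiftSeq_zero, dSeq_apply, horRescEval, horCoeff_zero, horDen, horNum] at hrec ⊢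
    push_cast at hrec ⊢
    linear_combination horS0 M a R * hrec
  | 1 =>
    have hrec := horCoeff_rec_one (m := m) h hp
    simp only [horODECoeff, shiftSeq_zero, shiftSeq_succ, dSeq_apply, horRescEval, horCoeff_zero, horDen,
      horNum] at hrec ⊢
    push_cast at hrec ⊢
    linear_combination horS0 M a R ^ 2 * hrec
  | k + 2 =>
    have hrec := horCoeff_rec_add_two (m := m) h hp k
    simp only [horODECoeff, shiftSeq_succ, dSeq_apply, horRescEval, horDen, horNum] at hrec ⊢
    push_cast at hrec ⊢
    linear_combination horS0 M a R ^ (k + 3) * hrec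

/-- **The Frobenius solution solves the ingoing radial equation** (in the variable `x = r − r₊`,
complex `x` with `‖x‖ < ρ(R)/2`):
`x(x + d) u'' + ((2 − 4iMω) x + (d + 2iβ)) u' + (q₂ x² + q₁ x + q₀) u = 0`, i.e. (with `r = r₊ + x`)
`Δ u'' + (Δ' + 2iam − 4iωMr) u' + (ω²(r² + 2Mr) − 2iωM − Λ − σr²) u = 0`. SR, CMP 329 (2014), §2 (2.3)
and App. C §C.1; Hartman Ch. IV §12. [cite: ShlapentokhRothman2014KleinGordon, App. C §C.1] -/
theorem horFun_ode (h : Kerr.IsSubextremal M a) (m : ℤ) {R : ℝ} (hR : 0 ≤ R) {p : ℂ × ℂ × ℂ}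
    (hp : p ∈ horGood M a) (hpR : p ∈ horBoxClosed R) {x : ℂ} (hx : ‖x‖ < horRho M a R / 2) :
    x * (x + horD M a) * horDer2 M a m R p x +
      ((2 - 4 * Complex.I * M * p.1) * x + ((horD M a : ℂ) + 2 * Complex.I * horBeta M a m p.1)) *
        horDer M a m R p x +
      (horQ2 p * x ^ 2 + horQ1 M a p * x + horQ0 M a p) * horFun M a m p x = 0 := by
  set A := horRescEval M a m R p with hA_def
  set s : ℂ := horScale M a R * x with hs_def
  set s₀ : ℂ := horS0 M a R with hs0_def
  have hs : ‖s‖ < 1 := norm_horScale_mul_lt h hR hx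
  have hA : PolyBounded A := polyBounded_horRescEval h m hR hp hpR
  have hDA : PolyBounded (dSeq A) := hA.dSeq
  have hDDA : PolyBounded (dSeq (dSeq A)) := hDA.dSeq
  have hs00 : s₀ ≠ 0 := horS0_ne_zero h hR
  have hσ : horScale M a R = s₀⁻¹ := (eq_inv_of_mul_eq_one_right (horS0_mul_horScale h hR))
  -- shifted series
  have e1 : cseries (shiftSeq (dSeq (dSeq A))) s = s * cseries (dSeq (dSeq A)) s := cseries_shiftSeq hDDA hs
  have e2 : cseries (shiftSeq (shiftSeq (dSeq (dSeq A)))) s = s * (s * cseries (dSeq (dSeq A)) s) := by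
    rw [cseries_shiftSeq hDDA.shift hs, e1]
  have e3 : cseries (shiftSeq (dSeq A)) s = s * cseries (dSeq A) s := cseries_shiftSeq hDA hs
  have e4 : cseries (shiftSeq A) s = s * cseries A s := cseries_shiftSeq hA hs
  have e5 : cseries (shiftSeq (shiftSeq A)) s = s * (s * cseries A s) := by
    rw [cseries_shiftSeq hA.shift hs, e4]
  -- the combination is the zero series
  have hzero : cseries (horODECoeff M a m R p) s = 0 := cseries_eq_zero (horODECoeff_eq_zero h m R hp) s
  -- expand it by linearity
  have p1 : PolyBounded (fun k ↦ s₀ * shiftSeq (shiftSeq (dSeq (dSeq A))) k) := hDDA.shift.shift.const_mul _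
  have p2 : PolyBounded (fun k ↦ (horD M a : ℂ) * shiftSeq (dSeq (dSeq A)) k) := hDDA.shift.const_mul _
  have p3 : PolyBounded (fun k ↦ (2 - 4 * Complex.I * M * p.1) * s₀ * shiftSeq (dSeq A) k) :=
    hDA.shift.const_mul _
  have p4 : PolyBounded (fun k ↦ ((horD M a : ℂ) + 2 * Complex.I * horBeta M a m p.1) * dSeq A k) := hDA.const_mul _
  have p5 : PolyBounded (fun k ↦ horQ2 p * s₀ ^ 3 * shiftSeq (shiftSeq A) k) := hA.shift.shift.const_mul _
  have p6 : PolyBounded (fun k ↦ horQ1 M a p * s₀ ^ 2 * shiftSeq A k) := hA.shift.const_mul _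
  have p7 : PolyBounded (fun k ↦ horQ0 M a p * s₀ * A k) := hA.const_mul _
  have hsum : cseries (horODECoeff M a m R p) s =
      s₀ * cseries (shiftSeq (shiftSeq (dSeq (dSeq A)))) s + (horD M a : ℂ) * cseries (shiftSeq (dSeq (dSeq A))) s +
        (2 - 4 * Complex.I * M * p.1) * s₀ * cseries (shiftSeq (dSeq A)) s +
        ((horD M a : ℂ) + 2 * Complex.I * horBeta M a m p.1) * cseries (dSeq A) s +
        horQ2 p * s₀ ^ 3 * cseries (shiftSeq (shiftSeq A)) s + horQ1 M a p * s₀ ^ 2 * cseries (shiftSeq A) s +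
        horQ0 M a p * s₀ * cseries A s := by
    have step : cseries (horODECoeff M a m R p) s =
        cseries (fun k ↦ s₀ * shiftSeq (shiftSeq (dSeq (dSeq A))) k + (horD M a : ℂ) * shiftSeq (dSeq (dSeq A)) k +
          (2 - 4 * Complex.I * M * p.1) * s₀ * shiftSeq (dSeq A) k +
          ((horD M a : ℂ) + 2 * Complex.I * horBeta M a m p.1) * dSeq A k +
          horQ2 p * s₀ ^ 3 * shiftSeq (shiftSeq A) k + horQ1 M a p * s₀ ^ 2 * shiftSeq A k) s +
        cseries (fun k ↦ horQ0 M a p * s₀ * A k) s := by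
      rw [← cseries_add ((((((p1.add p2).add p3).add p4).add p5).add p6)) p7 hs]
      rfl
    rw [step, cseries_add (((((p1.add p2).add p3).add p4).add p5)) p6 hs,
      cseries_add ((((p1.add p2).add p3).add p4)) p5 hs, cseries_add (((p1.add p2).add p3)) p4 hs,
      cseries_add ((p1.add p2)) p3 hs, cseries_add p1 p2 hs]
    simp only [cseries_const_mul]
  -- assemble
  have hu : horFun M a m p x = cseries A s := horFun_eq_cseries h m hR p x
  have hu' : horDer M a m R p x = s₀⁻¹ * cseries (dSeq A) s := by
    show horScale M a R * cseries (dSeq A) s = _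
    rw [hσ]
  have hu'' : horDer2 M a m R p x = s₀⁻¹ ^ 2 * cseries (dSeq (dSeq A)) s := by
    show horScale M a R ^ 2 * cseries (dSeq (dSeq A)) s = _
    rw [hσ]
  have hxs : x = s₀ * s := by rw [hs_def, hσ, ← mul_assoc, mul_inv_cancel₀ hs00, one_mul]
  rw [hsum, e1, e2, e3, e4, e5] at hzero
  rw [hu, hu', hu'', hxs]
  field_simp
  linear_combination hzero

end Solution

/-! ### Joint smoothness in the variable and the parameters -/

section Smooth

/-- The bounded weight `wₖ = (1/2)ᵏ` converting the fixed point `cₖ ρᵏ` into the evaluation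
coefficients `cₖ (ρ/2)ᵏ`. [folklore] -/
def horWeight : CSeq := CSeq.mk (fun k ↦ (((1 / 2 : ℝ) ^ k : ℝ) : ℂ)) 1 fun k ↦ by
  rw [Complex.norm_real, Real.norm_eq_abs, abs_of_nonneg (by positivity)]
  exact pow_le_one₀ (by norm_num) (by norm_num)

/-- Coordinates of the weight. [folklore] -/
theorem horWeight_apply (k : ℕ) : horWeight k = (((1 / 2 : ℝ) ^ k : ℝ) : ℂ) := rfl

variable (M a : ℝ) (m : ℤ)

/-- **The evaluation coefficient sequence** `p ↦ (cₖ(p) (ρ/2)ᵏ)ₖ ∈ ℕ →ᵇ ℂ` as a continuous linear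
image of the fixed point. [folklore] -/
def horEvalSeq (R : ℝ) (p : ℂ × ℂ × ℂ) : CSeq := CSeq.mulCLM horWeight (horFix M a m (horRho M a R) p)

variable {M a m}

/-- On the box, the evaluation sequence has coordinates `aₖ = cₖ (ρ/2)ᵏ`. [folklore] -/
theorem horEvalSeq_apply (h : Kerr.IsSubextremal M a) (m : ℤ) {R : ℝ} (hR : 0 ≤ R) {p : ℂ × ℂ × ℂ}
    (hp : p ∈ horGood M a) (hpR : p ∈ horBoxClosed R) (k : ℕ) :
    horEvalSeq M a m R p k = horRescEval M a m R p k := by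
  have hT1 : ‖horOp M a m (horRho M a R) p‖ < 1 := (norm_horOp_le h m hR hp hpR).trans_lt (by norm_num)
  rw [horEvalSeq, CSeq.mulCLM_apply, horFix_apply h hp hT1 k, horResc, horWeight_apply, horRescEval, horS0]
  push_cast
  ring

/-- `p ↦ horEvalSeq R p` is `C^∞` on `horGood ∩ horBox R`. [folklore] -/
theorem contDiffOn_horEvalSeq (h : Kerr.IsSubextremal M a) (m : ℤ) {R : ℝ} (hR : 0 ≤ R) {n : WithTop ℕ∞} :
    ContDiffOn ℂ n (fun p : ℂ × ℂ × ℂ ↦ horEvalSeq M a m R p) (horGood M a ∩ horBox R) :=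
  ((CSeq.mulCLM horWeight).contDiff.comp_contDiffOn (contDiffOn_horFix h m hR))

variable (M a)

/-- The open region `{‖x‖ < ρ(R)/2} × (horGood ∩ horBox R)`. [folklore] -/
def horRegion (R : ℝ) : Set (ℂ × (ℂ × ℂ × ℂ)) :=
  {q | ‖q.1‖ < horRho M a R / 2 ∧ q.2 ∈ horGood M a ∩ horBox R}

variable {M a}

/-- The region is open. [folklore] -/
theorem isOpen_horRegion (R : ℝ) : IsOpen (horRegion M a R) :=
  (isOpen_lt continuous_fst.norm continuous_const).inter
    (((isOpen_horGood M a).inter (isOpen_horBox R)).preimage continuous_snd)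

/-- **Joint smoothness of the Frobenius solution in the variable and the parameters**:
`(x, p) ↦ u(x; p)` is `C^∞` over `ℂ` (holomorphic) on `{‖x‖ < ρ(R)/2} × (horGood ∩ horBox R)`.
SR, CMP 329 (2014), App. A Lemma A.1 ("`ρ` is holomorphic for `z ∈ B_r(z₀)` and `λ ∈ U`").
[cite: ShlapentokhRothman2014KleinGordon, App. A Lemma A.1] -/
theorem contDiffOn_horFun (h : Kerr.IsSubextremal M a) (m : ℤ) {R : ℝ} (hR : 0 ≤ R) {n : WithTop ℕ∞}
    (hn : n ≤ ∞) :
    ContDiffOn ℂ n (fun q : ℂ × (ℂ × ℂ × ℂ) ↦ horFun M a m q.2 q.1) (horRegion M a R) := by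
  intro q hq
  have hO := isOpen_horRegion (M := M) (a := a) R
  have hβ : ContDiffAt ℂ n (fun q : ℂ × (ℂ × ℂ × ℂ) ↦ horEvalSeq M a m R q.2) q :=
    ((contDiffOn_horEvalSeq h m hR).contDiffAt
      (((isOpen_horGood M a).inter (isOpen_horBox R)).mem_nhds hq.2)).comp q contDiffAt_snd
  have hξ : ContDiffAt ℂ n (fun q : ℂ × (ℂ × ℂ × ℂ) ↦ horScale M a R * q.1) q := contDiffAt_const.mul contDiffAt_fst
  have hc := contDiffAt_evCLM_apply hn 0 hβ hξ (norm_horScale_mul_lt h hR hq.1)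
  have heq : (fun q : ℂ × (ℂ × ℂ × ℂ) ↦ horFun M a m q.2 q.1) =ᶠ[𝓝 q]
      fun q : ℂ × (ℂ × ℂ × ℂ) ↦ evCLM 0 (horScale M a R * q.1) (horEvalSeq M a m R q.2) := by
    filter_upwards [hO.mem_nhds hq] with q' hq'
    rw [evCLM_zero_apply (norm_horScale_mul_lt h hR hq'.1), horFun_eq_cseries h m hR]
    exact cseries_congr (fun k ↦ (horEvalSeq_apply h m hR hq'.2.1 (horBox_subset_horBoxClosed R hq'.2.2) k).symm) _
  exact (hc.congr_of_eventuallyEq heq).contDiffWithinAt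

/-- **Joint smoothness of the `x`-derivative** `(x, p) ↦ u'(x; p)` on the same region.
[cite: ShlapentokhRothman2014KleinGordon, App. A Lemma A.1] -/
theorem contDiffOn_horDer (h : Kerr.IsSubextremal M a) (m : ℤ) {R : ℝ} (hR : 0 ≤ R) {n : WithTop ℕ∞}
    (hn : n ≤ ∞) :
    ContDiffOn ℂ n (fun q : ℂ × (ℂ × ℂ × ℂ) ↦ horDer M a m R q.2 q.1) (horRegion M a R) := by
  intro q hq
  have hO := isOpen_horRegion (M := M) (a := a) R
  have hβ : ContDiffAt ℂ n (fun q : ℂ × (ℂ × ℂ × ℂ) ↦ horEvalSeq M a m R q.2) q :=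
    ((contDiffOn_horEvalSeq h m hR).contDiffAt
      (((isOpen_horGood M a).inter (isOpen_horBox R)).mem_nhds hq.2)).comp q contDiffAt_snd
  have hξ : ContDiffAt ℂ n (fun q : ℂ × (ℂ × ℂ × ℂ) ↦ horScale M a R * q.1) q := contDiffAt_const.mul contDiffAt_fst
  have hc := (contDiffAt_evCLM_apply hn 1 hβ hξ (norm_horScale_mul_lt h hR hq.1)).const_smul (horScale M a R)
  have heq : (fun q : ℂ × (ℂ × ℂ × ℂ) ↦ horDer M a m R q.2 q.1) =ᶠ[𝓝 q]
      fun q : ℂ × (ℂ × ℂ × ℂ) ↦ horScale M a R • evCLM 1 (horScale M a R * q.1) (horEvalSeq M a m R q.2) := by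
    filter_upwards [hO.mem_nhds hq] with q' hq'
    rw [evCLM_one_apply (norm_horScale_mul_lt h hR hq'.1), horDer, smul_eq_mul]
    congr 1
    refine cseries_congr (fun k ↦ ?_) _
    rw [dSeq_apply, dSeq_apply, horEvalSeq_apply h m hR hq'.2.1 (horBox_subset_horBoxClosed R hq'.2.2) (k + 1)]
  exact (hc.congr_of_eventuallyEq heq).contDiffWithinAt

/-- Smoothness in the parameters alone at a fixed point `x₀` (`‖x₀‖ < ρ(R)/2`):
`p ↦ u(x₀; p)` and `p ↦ u'(x₀; p)` are `C^∞` on `horGood ∩ horBox R`. [folklore] -/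
theorem contDiffOn_horFun_param (h : Kerr.IsSubextremal M a) (m : ℤ) {R : ℝ} (hR : 0 ≤ R) {x₀ : ℂ}
    (hx₀ : ‖x₀‖ < horRho M a R / 2) {n : WithTop ℕ∞} (hn : n ≤ ∞) :
    ContDiffOn ℂ n (fun p : ℂ × ℂ × ℂ ↦ horFun M a m p x₀) (horGood M a ∩ horBox R) ∧
      ContDiffOn ℂ n (fun p : ℂ × ℂ × ℂ ↦ horDer M a m R p x₀) (horGood M a ∩ horBox R) := by
  constructor
  · intro p hp
    have hmem : (x₀, p) ∈ horRegion M a R := ⟨hx₀, hp⟩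
    have hc := (contDiffOn_horFun h m hR hn).contDiffAt ((isOpen_horRegion (M := M) (a := a) R).mem_nhds hmem)
    exact (hc.comp p (contDiffAt_const.prodMk contDiffAt_id)).contDiffWithinAt
  · intro p hp
    have hmem : (x₀, p) ∈ horRegion M a R := ⟨hx₀, hp⟩
    have hc := (contDiffOn_horDer h m hR hn).contDiffAt ((isOpen_horRegion (M := M) (a := a) R).mem_nhds hmem)
    exact (hc.comp p (contDiffAt_const.prodMk contDiffAt_id)).contDiffWithinAt

end Smooth

end Literature.Barriers.FinalStateConjecture
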